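/-
Copyright (c) 2026. All rights reserved.
Released under Apache 2.0 license as described in the file LICENSE.
-/
import Literature.Geometry.Kaehler.ComplexTorusQuaternionXSixSpecialPointsBurnside
import Literature.Geometry.Kaehler.ComplexTorusQuaternionXSixPlusSpecialPointsSmall
import HarnessLib

/-!
# The fibres of `X₆ → X₆⁺ = X₆/W` over the special cycle `Z(t)`, for EVERY `t`: each fibre of
# `Pt(t)/Γ₆ → Pt(t)/Γ₆⁺` has `4` or `2` classes — `2` exactly for the fibre of the `Z(1)`-, `Z(3)`- or `Z(6)`-points —
# and for `t > 0` there is AT MOST ONE two-class fibre, present iff `t ∈ ℤ² ∪ 3ℤ² ∪ 6ℤ²`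

[tag: complex_torus] [tag: abelian_surface] [tag: quaternion_multiplication] [tag: complex_multiplication]
[tag: shimura_curve] [tag: special_cycles] [tag: atkin_lehner] [tag: elliptic_points]

Lane `lit-hodgefound`, seat p12, row g37-#2 — THEOREMS ONLY (no definition, no named fact, no instance); the orbit-level
refinement of g36-#2 `…XSixSpecialPointsBurnside` (Burnside's COUNT `#(Pt(t)/Γ₆) + Σ_{t₀ = 1,3,6} #((Pt(t) ∩ Pt(t₀))/Γ₆) =
4·#(Pt(t)/Γ₆⁺)` for the Klein four-group `W` on `Pt(t)/Γ₆`). Setting as in all `…XSix…` files: `B = (−1,3)_ℚ`,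
`𝔬 = ℤ⟨1, i, j, ij⟩`, the maximal order `O₆` as the predicate `a ∈ 𝔬 ∨ a − e ∈ 𝔬`, `Γ₆ = O₆¹`, `ρ = rho (-1) 3`,
`Pt(t) = {τ ∈ ℌ : ρ(x)τ = τ for some x ∈ 𝔬, tr x = 0, nr x = t}`, `Γ₆⁺ = N(O₆)⁺ = {g ≠ 0 : gO₆ ⊆ O₆g, nr g > 0}`,
`w₂ = 1 + i` (norm `2`), `μ = 3 + j + ij` (norm `3`). The projection `Pt(t)/Γ₆ → Pt(t)/Γ₆⁺` (the restriction of the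
four-sheeted cover `X₆ → X₆⁺ = X₆/W` to the points of `Z(t)`) is Mathlib's `Quot.factor` along
`specialPointsPlus_rel_of_specialPoints_rel` (`Γ₆ ⊂ Γ₆⁺`); its fibres are inline subtypes.

## The mechanism (the print)

`N(O₆) = ℚ^×·O₆^{±1}·{1, w₂, μ, w₂μ}` (Vignéras: «`N(O)/O^×ℚ^× ≅ (ℤ/2ℤ)^{2m}`»; Bayer–Travesa: «`Γ₆⁺/Γ₆ ≅ (ℤ/2ℤ)²`»),
so a fibre of `Pt(t)/Γ₆ → Pt(t)/Γ₆⁺` is a `W`-orbit `{[τ], [ρ(w₂)τ], [ρ(μ)τ], [ρ(w₂μ)τ]}`; the class `[τ]` is fixed by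
`ω₂`, `ω₃`, `ω₆` iff `τ ∈ Pt(1)`, `Pt(3)`, `Pt(6)` (Ogg's fixed points of `w(m)`: «`μ² = −m`; the other possibilities
are `ε = 1 + ζ₄`, if `m = 2`, and `ε = 1 − ζ₃` if `m = 3`»), and `Pt(1)`, `Pt(3)`, `Pt(6)` are pairwise disjoint (two
special vectors at one CM point are proportional, KRY Prop. 3.4.1, and `3`, `6`, `2` are not rational squares). Hence the
stabiliser of a class in `W ≅ (ℤ/2ℤ)²` is trivial or of order `2`, the orbit has `4` or `2` classes, and for `t > 0` the
two-class orbits lie over the single point of `Z(t₀)` on `X₆⁺` (`#(Pt(t₀)/Γ₆⁺) = 1`, `t₀ = 1, 3, 6`), `t₀` being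
determined by `t = m²t₀`.

* S. Kudla, M. Rapoport, T. Yang (2006), §3.4: Prop. 3.4.1, Lemma 3.4.3, (3.4.6), (3.4.11)–(3.4.13), Remark 3.4.7 («the
  group of Atkin-Lehner involutions permutes the components transitively»). [cite: KudlaRapoportYang2006, §3.4]
* A. P. Ogg (1983), §2 pp. 283–284, (2)–(4). [cite: Ogg1983RealPoints, §2]
* P. Bayer, A. Travesa (2007), §2 («`Γ₆⁺/Γ₆ ≅ (ℤ/2ℤ)²`»), §7 Table 9 (`t₆⁺`: `e_{P₀} = 2`, `e_{P₄} = 6`, `e_{P₆} = 4`).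
  [cite: BayerTravesa2007, §2 and §7]
* M.-F. Vignéras (1980), Ch. IV §3 B. [cite: VignerasLNM800, Ch. IV §3 B]

## What is proved

* §1 **`specialPointsPlus_rel_of_specialPoints_rel`** (`Γ₆`-equivalent ⟹ `Γ₆⁺`-equivalent), **`moebius_w2_mem_specialPoints`**,
  **`moebius_mu_mem_specialPoints`** (`ρ(w₂)`, `ρ(μ)` preserve `Pt(t)`), **`specialPointsPlus_rel_iff_exists_normOne_mul_word`**
  (`p ∼_{Γ₆⁺} q ⟺ q = ρ(v·w₂^k·μ^l)p` for some `v ∈ Γ₆`, `k, l ≤ 1`).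
* §2 per fibre (every `t`): **`card_fibre_eq_two_of_mem_one`**, **`…_three`**, **`…_six`** (the fibre through a `Z(1)`-,
  `Z(3)`-, `Z(6)`-point has exactly `2` classes), **`card_fibre_eq_four_of_not_mem`** (every other fibre has `4`),
  **`card_fibre_eq_two_or_eq_four`**, **`card_fibre_eq_two_iff`**, **`card_fibre_eq_four_iff`**.
* §3 globally (`t > 0`): **`subsingleton_twoFibres`**, **`card_twoFibres_le_one`**, **`card_twoFibres_eq_one_iff`**
  (`⟺ t ∈ ℤ² ∪ 3ℤ² ∪ 6ℤ²`), **`card_twoFibres_eq_zero_iff`** — with `#(Pt(t)/Γ₆) = 4·#(Pt(t)/Γ₆⁺) − 2·#(two-class fibres)`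
  this is the orbit structure behind `…XSixSpecialPointsCongruences`.

## Honest scope

Statements about the bare quotient TYPES of the `…XSix…` files and the map `Quot.factor` between them; nothing identifies
them with the points of algebraic models of `X₆`, `X₆⁺` or with a ramification divisor. 0 definitions, 0 named facts,
0 instances — net debt `0`.
-/

noncomputable section

set_option maxSynthPendingDepth 3

open Quaternion Function

namespace Literature.Geometry.Kaehler.ComplexTorus.QuaternionType

/-! ## §0 Helpers -/

section Helpers

/-- `ρ(1)` acts trivially. [folklore] -/
private theorem moebius_rho_castQ_one₁₇ (τ : ℂ) :
    moebius (rho (-1) 3 (by norm_num) (castQ (-1) 3 (1 : ℍ[ℚ,((-1 : ℤ) : ℚ),((3 : ℤ) : ℚ)]))) τ = τ := by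
  rw [castQ_one, map_one, moebius_apply]
  simp

/-- `ρ(wv) = ρ(w) ∘ ρ(v)` on `ℌ` for positive norms. [folklore] -/
private theorem moebius_rho_castQ_mul₁₇ {v w : ℍ[ℚ,((-1 : ℤ) : ℚ),((3 : ℤ) : ℚ)]} (hv : 0 < (v * star v).re)
    (hw : 0 < (w * star w).re) {τ : ℂ} (hτ : 0 < τ.im) :
    moebius (rho (-1) 3 (by norm_num) (castQ (-1) 3 (w * v))) τ =
      moebius (rho (-1) 3 (by norm_num) (castQ (-1) 3 w)) (moebius (rho (-1) 3 (by norm_num) (castQ (-1) 3 v)) τ) := by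
  rw [castQ_mul, map_mul]
  exact moebius_mul_of_det_pos (det_rho_castQ_pos _ hw) (det_rho_castQ_pos _ hv) (UpperHalfPlane.mk τ hτ)

/-- Norms of the Atkin–Lehner words `w₂^k μ^l`, `k, l ≤ 1`: `1, 3, 2, 6`. [folklore] -/
private theorem norm_atkinLehner_word₁₇ (k l : ℕ) (hk : k ≤ 1) (hl : l ≤ 1) :
    (((⟨1, 1, 0, 0⟩ : ℍ[ℚ,((-1 : ℤ) : ℚ),((3 : ℤ) : ℚ)]) ^ k * ⟨3, 0, 1, 1⟩ ^ l) *
        star ((⟨1, 1, 0, 0⟩ : ℍ[ℚ,((-1 : ℤ) : ℚ),((3 : ℤ) : ℚ)]) ^ k * ⟨3, 0, 1, 1⟩ ^ l)).re = 2 ^ k * 3 ^ l := by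
  have hnm : ((⟨3, 0, 1, 1⟩ : ℍ[ℚ,((-1 : ℤ) : ℚ),((3 : ℤ) : ℚ)]) * star ⟨3, 0, 1, 1⟩).re = 3 := by
    rw [QuaternionAlgebra.star_mk, QuaternionAlgebra.mk_mul_mk]; norm_num
  have hnw : ((⟨1, 1, 0, 0⟩ : ℍ[ℚ,((-1 : ℤ) : ℚ),((3 : ℤ) : ℚ)]) * star ⟨1, 1, 0, 0⟩).re = 2 := by
    rw [QuaternionAlgebra.star_mk, QuaternionAlgebra.mk_mul_mk]; norm_num
  rcases Nat.le_one_iff_eq_zero_or_eq_one.1 hk with rfl | rfl <;>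
    rcases Nat.le_one_iff_eq_zero_or_eq_one.1 hl with rfl | rfl
  · rw [pow_zero, pow_zero, mul_one, star_one, mul_one, QuaternionAlgebra.re_one]; norm_num
  · rw [pow_zero, pow_one, one_mul, hnm]; norm_num
  · rw [pow_one, pow_zero, mul_one, hnw]; norm_num
  · rw [pow_one, pow_one, re_mul_mul_star_mul, hnw, hnm]; norm_num

/-- **`ρ(W)` preserves `Pt(t)`** for `W` of positive norm normalising `𝔬` on the left: `ρ(W)τ` is fixed by
`y = Wx̂W⁻¹ ∈ 𝔬`, `tr y = 0`, `nr y = t`. [folklore] -/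
private theorem moebius_mem_specialPoints₁₇ {t : ℚ} {W : ℍ[ℚ,((-1 : ℤ) : ℚ),((3 : ℤ) : ℚ)]} {n : ℚ} (hWn : (W * star W).re = n)
    (hn : 0 < n) (hLo : ∀ z ∈ order (-1) 3, ∃ y ∈ order (-1) 3, W * z = y * W)
    {τ : ℂ} (hτ : 0 < τ.im) {x : ℍ[ℚ,((-1 : ℤ) : ℚ),((3 : ℤ) : ℚ)]} (hx : x ∈ order (-1) 3) (hre : x.re = 0) (hxn : (x * star x).re = t)
    (hfix : moebius (rho (-1) 3 (by norm_num) (castQ (-1) 3 x)) τ = τ) :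
    0 < (moebius (rho (-1) 3 (by norm_num) (castQ (-1) 3 W)) τ).im ∧
    ∃ y : ℍ[ℚ,((-1 : ℤ) : ℚ),((3 : ℤ) : ℚ)], y ∈ order (-1) 3 ∧ y.re = 0 ∧ (y * star y).re = t ∧
      moebius (rho (-1) 3 (by norm_num) (castQ (-1) 3 y)) (moebius (rho (-1) 3 (by norm_num) (castQ (-1) 3 W)) τ) =
        moebius (rho (-1) 3 (by norm_num) (castQ (-1) 3 W)) τ := by
  have h3 : (0 : ℤ) < 3 := by norm_num
  have hWpos : 0 < (W * star W).re := by rw [hWn]; exact hn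
  refine ⟨im_moebius_rho_pos h3 hWpos hτ, ?_⟩
  obtain ⟨y, hy, e⟩ := hLo x hx
  -- `W x W̄ = n • y`
  have e2 : W * x * star W = (n : ℚ) • y := by
    rw [e, mul_assoc, QuaternionAlgebra.mul_star_eq_coe, hWn, QuaternionAlgebra.mul_coe_eq_smul]
  have hyre : y.re = 0 := by
    have h0 := congrArg QuaternionAlgebra.re e2
    rw [re_conj_eq, hWn, hre, mul_zero, QuaternionAlgebra.re_smul, smul_eq_mul] at h0
    rcases mul_eq_zero.1 h0.symm with h1 | h1
    · exact absurd h1 hn.ne'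
    · exact h1
  obtain ⟨⟨p₁, p₂, p₃⟩, hpe, hpQ⟩ := exists_eq_mk_of_mem_order_re_zero hy hyre
  dsimp only at hpe hpQ
  have hyn : (y * star y).re = t := by
    have hN := norm_conj_eq W x
    rw [e2, hWn, hxn, hpe, QuaternionAlgebra.smul_mk, smul_zero] at hN
    simp only [smul_eq_mul] at hN
    rw [pureVec_norm] at hN
    rw [hpe, pureVec_norm]
    have hn2 : (n : ℚ) ^ 2 ≠ 0 := pow_ne_zero 2 hn.ne'
    have : n ^ 2 * ((p₁ : ℚ) ^ 2 - 3 * (p₂ : ℚ) ^ 2 - 3 * (p₃ : ℚ) ^ 2) = n ^ 2 * t := by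
      rw [← hN]; ring
    exact mul_left_cancel₀ hn2 this
  refine ⟨y, hy, hyre, hyn, ?_⟩
  have hf := moebius_conj_fixed_of_im_ne_zero h3 (ε := W) (x := x) hWpos.ne' hτ.ne' hfix
  rw [e2, moebius_rho_castQ_smul hn.ne'] at hf
  exact hf

/-- `1 ≠ 3c²` in `ℚ`. [folklore] -/
private theorem not_one_eq_sq_mul_three₁₇ {c : ℚ} (h : (1 : ℚ) = c ^ 2 * 3) : False := by
  have hsq : IsSquare ((1 : ℚ) / 3) := ⟨c, by rw [← sq]; field_simp; linear_combination h⟩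
  norm_num at hsq

/-- `1 ≠ 6c²` in `ℚ`. [folklore] -/
private theorem not_one_eq_sq_mul_six₁₇ {c : ℚ} (h : (1 : ℚ) = c ^ 2 * 6) : False := by
  have hsq : IsSquare ((1 : ℚ) / 6) := ⟨c, by rw [← sq]; field_simp; linear_combination h⟩
  norm_num at hsq

/-- `3 ≠ 6c²` in `ℚ`. [folklore] -/
private theorem not_three_eq_sq_mul_six₁₇ {c : ℚ} (h : (3 : ℚ) = c ^ 2 * 6) : False := by
  have hsq : IsSquare ((3 : ℚ) / 6) := ⟨c, by rw [← sq]; field_simp; linear_combination h⟩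
  norm_num at hsq

/-- **Klein-four fibre, ramified case**: for two commuting maps `ν, π` and a map `f` constant on `{q, νq, πq, νπq}` with
these as fibres, the fibre through a point fixed by `ν` and moved by `π` is `{q, πq}` — two elements. [folklore] -/
private theorem card_fibre_eq_two_of_fixed₁₇ {Q Q' : Type*} {ν π : Q → Q}
    (hc : ∀ q, π (ν q) = ν (π q)) {f : Q → Q'} (hfπ : ∀ q, f (π q) = f q)
    (hff : ∀ q₁ q₂, f q₁ = f q₂ → q₁ = q₂ ∨ q₁ = ν q₂ ∨ q₁ = π q₂ ∨ q₁ = ν (π q₂))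
    {q : Q} (hν : ν q = q) (hπ : π q ≠ q) :
    Nat.card {a : Q // f a = f q} = 2 := by
  rw [Nat.card_eq_two_iff]
  refine ⟨⟨q, rfl⟩, ⟨π q, hfπ q⟩, fun h ↦ hπ (congrArg Subtype.val h).symm, ?_⟩
  rw [Set.eq_univ_iff_forall]
  rintro ⟨a, ha⟩
  simp only [Set.mem_insert_iff, Set.mem_singleton_iff, Subtype.mk.injEq]
  rcases hff a q ha with h | h | h | h
  · exact Or.inl h
  · exact Or.inl (h.trans hν)
  · exact Or.inr h
  · exact Or.inr (h.trans (by rw [← hc, hν]))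

/-- **Klein-four fibre, free case**: if `ν, π` are commuting involutions and `q` is moved by `ν`, `π` and `νπ`, the fibre
`{q, νq, πq, νπq}` has four elements. [folklore] -/
private theorem card_fibre_eq_four_of_free₁₇ {Q Q' : Type*} {ν π : Q → Q}
    (hνν : ∀ q, ν (ν q) = q) (hππ : ∀ q, π (π q) = q) (hc : ∀ q, π (ν q) = ν (π q))
    {f : Q → Q'} (hfν : ∀ q, f (ν q) = f q) (hfπ : ∀ q, f (π q) = f q)
    (hff : ∀ q₁ q₂, f q₁ = f q₂ → q₁ = q₂ ∨ q₁ = ν q₂ ∨ q₁ = π q₂ ∨ q₁ = ν (π q₂))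
    {q : Q} (h₁ : ν q ≠ q) (h₂ : π q ≠ q) (h₃ : ν (π q) ≠ q) :
    Nat.card {a : Q // f a = f q} = 4 := by
  have hset : {a : Q | f a = f q} = ({q, ν q, π q, ν (π q)} : Set Q) := by
    ext a
    simp only [Set.mem_setOf_eq, Set.mem_insert_iff, Set.mem_singleton_iff]
    constructor
    · exact hff a q
    · rintro (rfl | rfl | rfl | rfl)
      · rfl
      · exact hfν q
      · exact hfπ q
      · rw [hfν, hfπ]
  have d12 : ν q ≠ π q := fun h ↦ h₃ (by rw [← h, hνν])
  have d13 : ν q ≠ ν (π q) := fun h ↦ h₂ ((hνν (π q)).symm.trans (by rw [← h, hνν]))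
  have d23 : π q ≠ ν (π q) := fun h ↦ h₁ (by
    have e := congrArg π h
    rw [hππ, hc, hππ] at e
    exact e.symm)
  have hn1 : q ∉ ({ν q, π q, ν (π q)} : Set Q) := by
    simp only [Set.mem_insert_iff, Set.mem_singleton_iff, not_or]
    exact ⟨fun h ↦ h₁ h.symm, fun h ↦ h₂ h.symm, fun h ↦ h₃ h.symm⟩
  have hn2 : ν q ∉ ({π q, ν (π q)} : Set Q) := by
    simp only [Set.mem_insert_iff, Set.mem_singleton_iff, not_or]
    exact ⟨d12, d13⟩
  have h4 : ({q, ν q, π q, ν (π q)} : Set Q).ncard = 4 := by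
    rw [Set.ncard_insert_of_notMem hn1, Set.ncard_insert_of_notMem hn2, Set.ncard_pair d23]
  change Nat.card ({a : Q | f a = f q} : Set Q) = 4
  rw [hset, Nat.card_coe_set_eq, h4]


/-- If `a·m² = b·n²` in `ℤ` with `m ≠ 0`, `b ≠ 0`, then `a/b` is a rational square. [folklore] -/
private theorem isSquare_div_of_mul_sq_eq₁₇ {a b m n : ℤ} (hm : m ≠ 0) (hb : b ≠ 0) (h : a * m ^ 2 = b * n ^ 2) :
    IsSquare ((a : ℚ) / b) := by
  have hm' : (m : ℚ) ≠ 0 := by exact_mod_cast hm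
  have hb' : (b : ℚ) ≠ 0 := by exact_mod_cast hb
  have h' : (a : ℚ) * (m : ℚ) ^ 2 = (b : ℚ) * (n : ℚ) ^ 2 := by exact_mod_cast h
  refine ⟨n / m, ?_⟩
  field_simp
  linear_combination h'

/-- `t = a·m² = b·n²`, `t ≠ 0`, is impossible when `a/b` is not a rational square (`b ≠ 0`). [folklore] -/
private theorem false_of_shapes₁₇ {t a b m n : ℤ} (ht : t ≠ 0) (hb : b ≠ 0) (hab : ¬ IsSquare ((a : ℚ) / b))
    (ha : t = a * m ^ 2) (hb' : t = b * n ^ 2) : False := by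
  have hm : m ≠ 0 := by
    rintro rfl
    rw [ha] at ht
    exact ht (by ring)
  exact hab (isSquare_div_of_mul_sq_eq₁₇ hm hb (ha.symm.trans hb'))

/-- `t = m²`, `t ≠ 0` ⟹ `t ≠ 3n²`. [folklore] -/
private theorem not_three_mul_sq_of_sq₁₇ {t m : ℤ} (ht : t ≠ 0) (hm : t = m ^ 2) : ¬ ∃ n : ℤ, t = 3 * n ^ 2 := by
  rintro ⟨n, hn⟩
  exact false_of_shapes₁₇ (a := 1) (b := 3) ht (by norm_num) (by norm_num) (by rw [one_mul]; exact hm) hn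

/-- `t = m²`, `t ≠ 0` ⟹ `t ≠ 6n²`. [folklore] -/
private theorem not_six_mul_sq_of_sq₁₇ {t m : ℤ} (ht : t ≠ 0) (hm : t = m ^ 2) : ¬ ∃ n : ℤ, t = 6 * n ^ 2 := by
  rintro ⟨n, hn⟩
  exact false_of_shapes₁₇ (a := 1) (b := 6) ht (by norm_num) (by norm_num) (by rw [one_mul]; exact hm) hn

/-- `t = 3m²`, `t ≠ 0` ⟹ `t ≠ 6n²`. [folklore] -/
private theorem not_six_mul_sq_of_three_mul_sq₁₇ {t m : ℤ} (ht : t ≠ 0) (hm : t = 3 * m ^ 2) :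
    ¬ ∃ n : ℤ, t = 6 * n ^ 2 := by
  rintro ⟨n, hn⟩
  exact false_of_shapes₁₇ (a := 3) (b := 6) ht (by norm_num) (by norm_num) hm hn

end Helpers

/-! ## §1 The projection `Pt(t)/Γ₆ → Pt(t)/Γ₆⁺` and the description of `Γ₆⁺`-equivalence by Atkin–Lehner words -/

section Projection

/-- **`Γ₆`-EQUIVALENT POINTS ARE `Γ₆⁺`-EQUIVALENT** (`Γ₆ = O₆¹ ⊂ Γ₆⁺`: a unit of `O₆` normalises `O₆` and has norm
`1 > 0`), so `Pt(t)/Γ₆ → Pt(t)/Γ₆⁺` is `Quot.factor` along this implication — the points of `Z(t)` under `X₆ → X₆⁺ = X₆/W`.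
[cite: BayerTravesa2007, §2 («`Γ₆⁺/Γ₆ ≅ (ℤ/2ℤ)²` … the quotient `X₆⁺`»)] [cite: VignerasLNM800, Ch. IV §3 B] -/
theorem specialPointsPlus_rel_of_specialPoints_rel (t : ℤ) :
    ∀ p q : {τ : ℂ // 0 < τ.im ∧ ∃ x : ℍ[ℚ,((-1 : ℤ) : ℚ),((3 : ℤ) : ℚ)],
        x ∈ order (-1) 3 ∧ x.re = 0 ∧ (x * star x).re = t ∧ moebius (rho (-1) 3 (by norm_num) (castQ (-1) 3 x)) τ = τ},
      (∃ v : ℍ[ℚ,((-1 : ℤ) : ℚ),((3 : ℤ) : ℚ)], (v ∈ order (-1) 3 ∨ v - ⟨1/2, 1/2, 1/2, -1/2⟩ ∈ order (-1) 3) ∧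
        v * star v = 1 ∧ moebius (rho (-1) 3 (by norm_num) (castQ (-1) 3 v)) p.1 = q.1) →
      ∃ g : ℍ[ℚ,((-1 : ℤ) : ℚ),((3 : ℤ) : ℚ)], g ≠ 0 ∧
        (∀ a : ℍ[ℚ,((-1 : ℤ) : ℚ),((3 : ℤ) : ℚ)], (a ∈ order (-1) 3 ∨ a - ⟨1/2, 1/2, 1/2, -1/2⟩ ∈ order (-1) 3) →
          ∃ b : ℍ[ℚ,((-1 : ℤ) : ℚ),((3 : ℤ) : ℚ)], (b ∈ order (-1) 3 ∨ b - ⟨1/2, 1/2, 1/2, -1/2⟩ ∈ order (-1) 3) ∧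
            g * a = b * g) ∧
        0 < (g * star g).re ∧ moebius (rho (-1) 3 (by norm_num) (castQ (-1) 3 g)) p.1 = q.1 := by
  rintro p q ⟨v, hv, hv1, h⟩
  have hvn : (v * star v).re = 1 := by rw [hv1, QuaternionAlgebra.re_one]
  refine ⟨v, fun h0 ↦ by rw [h0, zero_mul, QuaternionAlgebra.re_zero] at hvn; exact zero_ne_one hvn,
    (normalises_of_eq_smul_unit_mul_atkinLehner (g := v) (q := 1) hv (Or.inl hv1) 0 0
      (by rw [pow_zero, pow_zero, mul_one, mul_one, one_smul])).2.1, by rw [hvn]; exact one_pos, h⟩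

/-- **`ρ(w₂)` PRESERVES `Pt(t)`** (`w₂ = 1 + i`, norm `2`, `w₂𝔬 = 𝔬w₂`): `ρ(w₂)τ ∈ ℌ` is fixed by `w₂xw₂⁻¹ ∈ L(t)` — the
Atkin–Lehner involution `ω₂` acts on the points of `Z(t)`. [cite: KudlaRapoportYang2006, §3.4 Remark 3.4.7] [cite: Ogg1983RealPoints, §2 p. 283 («`𝒪 = μ𝒪μ⁻¹`»)] -/
theorem moebius_w2_mem_specialPoints {t : ℚ} {τ : ℂ} (hτ : 0 < τ.im)
    (h : ∃ x : ℍ[ℚ,((-1 : ℤ) : ℚ),((3 : ℤ) : ℚ)], x ∈ order (-1) 3 ∧ x.re = 0 ∧ (x * star x).re = t ∧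
        moebius (rho (-1) 3 (by norm_num) (castQ (-1) 3 x)) τ = τ) :
    0 < (moebius (rho (-1) 3 (by norm_num) (castQ (-1) 3 (⟨1, 1, 0, 0⟩ : ℍ[ℚ,((-1 : ℤ) : ℚ),((3 : ℤ) : ℚ)]))) τ).im ∧
    ∃ y : ℍ[ℚ,((-1 : ℤ) : ℚ),((3 : ℤ) : ℚ)], y ∈ order (-1) 3 ∧ y.re = 0 ∧ (y * star y).re = t ∧
      moebius (rho (-1) 3 (by norm_num) (castQ (-1) 3 y)) (moebius (rho (-1) 3 (by norm_num) (castQ (-1) 3 (⟨1, 1, 0, 0⟩ : ℍ[ℚ,((-1 : ℤ) : ℚ),((3 : ℤ) : ℚ)]))) τ) =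
        moebius (rho (-1) 3 (by norm_num) (castQ (-1) 3 (⟨1, 1, 0, 0⟩ : ℍ[ℚ,((-1 : ℤ) : ℚ),((3 : ℤ) : ℚ)]))) τ := by
  have h1O : ((1 : ℍ[ℚ,((-1 : ℤ) : ℚ),((3 : ℤ) : ℚ)]) ∈ order (-1) 3 ∨ (1 : ℍ[ℚ,((-1 : ℤ) : ℚ),((3 : ℤ) : ℚ)]) - ⟨1/2, 1/2, 1/2, -1/2⟩ ∈ order (-1) 3) := Or.inl (Subring.one_mem _)
  have h11 : (1 : ℍ[ℚ,((-1 : ℤ) : ℚ),((3 : ℤ) : ℚ)]) * star 1 = 1 ∨ (1 : ℍ[ℚ,((-1 : ℤ) : ℚ),((3 : ℤ) : ℚ)]) * star 1 = -1 := Or.inl (by rw [star_one, mul_one])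
  have hNw := normalises_of_eq_smul_unit_mul_atkinLehner (g := ⟨1, 1, 0, 0⟩) (q := 1) h1O h11 1 0
    (by rw [pow_one, pow_zero, mul_one, one_mul, one_smul])
  have hnw : ((⟨1, 1, 0, 0⟩ : ℍ[ℚ,((-1 : ℤ) : ℚ),((3 : ℤ) : ℚ)]) * star ⟨1, 1, 0, 0⟩).re = 2 := by
    rw [QuaternionAlgebra.star_mk, QuaternionAlgebra.mk_mul_mk]; norm_num
  obtain ⟨x, hx, hre, hxn, hfix⟩ := h
  exact moebius_mem_specialPoints₁₇ hnw two_pos hNw.1.1 hτ hx hre hxn hfix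

/-- **`ρ(μ)` PRESERVES `Pt(t)`** (`μ = 3 + j + ij`, norm `3`, `μ𝔬 = 𝔬μ`) — the Atkin–Lehner involution `ω₃` acts on the
points of `Z(t)`. [cite: KudlaRapoportYang2006, §3.4 Remark 3.4.7] [cite: Ogg1983RealPoints, §2 p. 283 («`𝒪 = μ𝒪μ⁻¹`»)] -/
theorem moebius_mu_mem_specialPoints {t : ℚ} {τ : ℂ} (hτ : 0 < τ.im)
    (h : ∃ x : ℍ[ℚ,((-1 : ℤ) : ℚ),((3 : ℤ) : ℚ)], x ∈ order (-1) 3 ∧ x.re = 0 ∧ (x * star x).re = t ∧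
        moebius (rho (-1) 3 (by norm_num) (castQ (-1) 3 x)) τ = τ) :
    0 < (moebius (rho (-1) 3 (by norm_num) (castQ (-1) 3 (⟨3, 0, 1, 1⟩ : ℍ[ℚ,((-1 : ℤ) : ℚ),((3 : ℤ) : ℚ)]))) τ).im ∧
    ∃ y : ℍ[ℚ,((-1 : ℤ) : ℚ),((3 : ℤ) : ℚ)], y ∈ order (-1) 3 ∧ y.re = 0 ∧ (y * star y).re = t ∧
      moebius (rho (-1) 3 (by norm_num) (castQ (-1) 3 y)) (moebius (rho (-1) 3 (by norm_num) (castQ (-1) 3 (⟨3, 0, 1, 1⟩ : ℍ[ℚ,((-1 : ℤ) : ℚ),((3 : ℤ) : ℚ)]))) τ) =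
        moebius (rho (-1) 3 (by norm_num) (castQ (-1) 3 (⟨3, 0, 1, 1⟩ : ℍ[ℚ,((-1 : ℤ) : ℚ),((3 : ℤ) : ℚ)]))) τ := by
  have h1O : ((1 : ℍ[ℚ,((-1 : ℤ) : ℚ),((3 : ℤ) : ℚ)]) ∈ order (-1) 3 ∨ (1 : ℍ[ℚ,((-1 : ℤ) : ℚ),((3 : ℤ) : ℚ)]) - ⟨1/2, 1/2, 1/2, -1/2⟩ ∈ order (-1) 3) := Or.inl (Subring.one_mem _)
  have h11 : (1 : ℍ[ℚ,((-1 : ℤ) : ℚ),((3 : ℤ) : ℚ)]) * star 1 = 1 ∨ (1 : ℍ[ℚ,((-1 : ℤ) : ℚ),((3 : ℤ) : ℚ)]) * star 1 = -1 := Or.inl (by rw [star_one, mul_one])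
  have hNm := normalises_of_eq_smul_unit_mul_atkinLehner (g := ⟨3, 0, 1, 1⟩) (q := 1) h1O h11 0 1
    (by rw [pow_zero, pow_one, one_mul, one_mul, one_smul])
  have hnm : ((⟨3, 0, 1, 1⟩ : ℍ[ℚ,((-1 : ℤ) : ℚ),((3 : ℤ) : ℚ)]) * star ⟨3, 0, 1, 1⟩).re = 3 := by
    rw [QuaternionAlgebra.star_mk, QuaternionAlgebra.mk_mul_mk]; norm_num
  obtain ⟨x, hx, hre, hxn, hfix⟩ := h
  exact moebius_mem_specialPoints₁₇ hnm three_pos hNm.1.1 hτ hx hre hxn hfix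

/-- **`Γ₆⁺`-EQUIVALENCE BY ATKIN–LEHNER WORDS: `p ∼_{Γ₆⁺} q ⟺ q = ρ(v·w₂^k·μ^l)p` for some `v ∈ Γ₆` and `k, l ≤ 1`** —
`N(O₆) = ℚ^×·O₆^{±1}·{1, w₂, μ, w₂μ}` (`normalises_maxOrder_iff_exists'`), the scalar acts trivially, and positivity of
the norm forces `vv̄ = +1`. [cite: VignerasLNM800, Ch. IV §3 B] [cite: BayerTravesa2007, §2 p. 318] [cite: Ogg1983RealPoints, §2 (2)] -/
theorem specialPointsPlus_rel_iff_exists_normOne_mul_word {t : ℤ} (p q : {τ : ℂ // 0 < τ.im ∧ ∃ x : ℍ[ℚ,((-1 : ℤ) : ℚ),((3 : ℤ) : ℚ)],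
        x ∈ order (-1) 3 ∧ x.re = 0 ∧ (x * star x).re = t ∧ moebius (rho (-1) 3 (by norm_num) (castQ (-1) 3 x)) τ = τ}) :
    (∃ g : ℍ[ℚ,((-1 : ℤ) : ℚ),((3 : ℤ) : ℚ)], g ≠ 0 ∧
        (∀ a : ℍ[ℚ,((-1 : ℤ) : ℚ),((3 : ℤ) : ℚ)], (a ∈ order (-1) 3 ∨ a - ⟨1/2, 1/2, 1/2, -1/2⟩ ∈ order (-1) 3) →
          ∃ b : ℍ[ℚ,((-1 : ℤ) : ℚ),((3 : ℤ) : ℚ)], (b ∈ order (-1) 3 ∨ b - ⟨1/2, 1/2, 1/2, -1/2⟩ ∈ order (-1) 3) ∧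
            g * a = b * g) ∧
        0 < (g * star g).re ∧ moebius (rho (-1) 3 (by norm_num) (castQ (-1) 3 g)) p.1 = q.1) ↔
    ∃ v : ℍ[ℚ,((-1 : ℤ) : ℚ),((3 : ℤ) : ℚ)], (v ∈ order (-1) 3 ∨ v - ⟨1/2, 1/2, 1/2, -1/2⟩ ∈ order (-1) 3) ∧ v * star v = 1 ∧
      ∃ k l : ℕ, k ≤ 1 ∧ l ≤ 1 ∧
        moebius (rho (-1) 3 (by norm_num) (castQ (-1) 3 (v * ((⟨1, 1, 0, 0⟩ : ℍ[ℚ,((-1 : ℤ) : ℚ),((3 : ℤ) : ℚ)]) ^ k * ⟨3, 0, 1, 1⟩ ^ l)))) p.1 = q.1 := by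
  constructor
  · rintro ⟨g, hg0, hL, hgn, hg⟩
    obtain ⟨r, v, k, l, hr, hv, h1, hk, hl, rfl⟩ := (normalises_maxOrder_iff_exists' hg0).1 hL
    have hWn := norm_atkinLehner_word₁₇ k l hk hl
    have hWpos : 0 < (((⟨1, 1, 0, 0⟩ : ℍ[ℚ,((-1 : ℤ) : ℚ),((3 : ℤ) : ℚ)]) ^ k * ⟨3, 0, 1, 1⟩ ^ l) * star ((⟨1, 1, 0, 0⟩ : ℍ[ℚ,((-1 : ℤ) : ℚ),((3 : ℤ) : ℚ)]) ^ k * ⟨3, 0, 1, 1⟩ ^ l)).re := by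
      rw [hWn]; positivity
    have hv1 : v * star v = 1 := by
      rcases h1 with h1 | h1
      · exact h1
      · exfalso
        have e1 : (r • (v * ⟨1, 1, 0, 0⟩ ^ k * ⟨3, 0, 1, 1⟩ ^ l) *
            star (r • (v * ⟨1, 1, 0, 0⟩ ^ k * ⟨3, 0, 1, 1⟩ ^ l))).re =
            r ^ 2 * ((v * star v).re * ((((⟨1, 1, 0, 0⟩ : ℍ[ℚ,((-1 : ℤ) : ℚ),((3 : ℤ) : ℚ)])) ^ k * ⟨3, 0, 1, 1⟩ ^ l) *
              star (((⟨1, 1, 0, 0⟩ : ℍ[ℚ,((-1 : ℤ) : ℚ),((3 : ℤ) : ℚ)])) ^ k * ⟨3, 0, 1, 1⟩ ^ l)).re) := by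
          rw [QuaternionAlgebra.star_smul, smul_mul_assoc, mul_smul_comm, ← mul_smul, QuaternionAlgebra.re_smul,
            smul_eq_mul, mul_assoc v, re_mul_mul_star_mul, pow_two]
        rw [e1, h1, QuaternionAlgebra.re_neg, QuaternionAlgebra.re_one] at hgn
        nlinarith [sq_nonneg r, mul_pos (pow_pos hr 2) hWpos]
    have hvn : (v * star v).re = 1 := by rw [hv1, QuaternionAlgebra.re_one]
    refine ⟨v, hv, hv1, k, l, hk, hl, ?_⟩
    rw [moebius_rho_castQ_smul hr.ne', mul_assoc] at hg
    exact hg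
  · rintro ⟨v, hv, hv1, k, l, hk, hl, h⟩
    have hvn : (v * star v).re = 1 := by rw [hv1, QuaternionAlgebra.re_one]
    have hWn := norm_atkinLehner_word₁₇ k l hk hl
    set g : ℍ[ℚ,((-1 : ℤ) : ℚ),((3 : ℤ) : ℚ)] := v * ((⟨1, 1, 0, 0⟩ : ℍ[ℚ,((-1 : ℤ) : ℚ),((3 : ℤ) : ℚ)]) ^ k * ⟨3, 0, 1, 1⟩ ^ l) with hg
    have hN := normalises_of_eq_smul_unit_mul_atkinLehner (g := g) (q := 1) hv (Or.inl hv1) k l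
      (by rw [hg, one_smul, mul_assoc])
    have hn : 0 < (g * star g).re := by
      rw [hg, re_mul_mul_star_mul, hvn, hWn]; positivity
    have hg0 : g ≠ 0 := by
      intro h0
      rw [h0, zero_mul, QuaternionAlgebra.re_zero] at hn
      exact lt_irrefl _ hn
    exact ⟨g, hg0, hN.2.1, hn, h⟩

end Projection

/-! ## §2 The fibres: `2` classes through a `Z(1)`-, `Z(3)`-, `Z(6)`-point, `4` classes otherwise -/

section Fibres

/-- The master computation: fibre sizes of `Pt(t)/Γ₆ → Pt(t)/Γ₆⁺` at the class of a point `p`, by the Klein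
four-group `W = {1, M, A, MA}` (`M = ρ(w₂)`, `A = ρ(μ)` on `Pt(t)/Γ₆`), whose orbits are the fibres and whose fixed
classes are the `Z(1)`-, `Z(3)`-, `Z(6)`-points. [folklore] -/
private theorem fibre_master₁₇ {t : ℤ} (p : {τ : ℂ // 0 < τ.im ∧ ∃ x : ℍ[ℚ,((-1 : ℤ) : ℚ),((3 : ℤ) : ℚ)],
        x ∈ order (-1) 3 ∧ x.re = 0 ∧ (x * star x).re = t ∧ moebius (rho (-1) 3 (by norm_num) (castQ (-1) 3 x)) τ = τ}) :
    ((∃ y : ℍ[ℚ,((-1 : ℤ) : ℚ),((3 : ℤ) : ℚ)], y ∈ order (-1) 3 ∧ y.re = 0 ∧ (y * star y).re = 1 ∧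
        moebius (rho (-1) 3 (by norm_num) (castQ (-1) 3 y)) p.1 = p.1) →
      Nat.card {a : Quot (fun p q : {τ : ℂ // 0 < τ.im ∧ ∃ x : ℍ[ℚ,((-1 : ℤ) : ℚ),((3 : ℤ) : ℚ)],
        x ∈ order (-1) 3 ∧ x.re = 0 ∧ (x * star x).re = t ∧ moebius (rho (-1) 3 (by norm_num) (castQ (-1) 3 x)) τ = τ} ↦
      ∃ v : ℍ[ℚ,((-1 : ℤ) : ℚ),((3 : ℤ) : ℚ)], (v ∈ order (-1) 3 ∨ v - ⟨1/2, 1/2, 1/2, -1/2⟩ ∈ order (-1) 3) ∧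
        v * star v = 1 ∧ moebius (rho (-1) 3 (by norm_num) (castQ (-1) 3 v)) p.1 = q.1) //
      Quot.factor
      (fun p q : {τ : ℂ // 0 < τ.im ∧ ∃ x : ℍ[ℚ,((-1 : ℤ) : ℚ),((3 : ℤ) : ℚ)],
        x ∈ order (-1) 3 ∧ x.re = 0 ∧ (x * star x).re = t ∧ moebius (rho (-1) 3 (by norm_num) (castQ (-1) 3 x)) τ = τ} ↦
        ∃ v : ℍ[ℚ,((-1 : ℤ) : ℚ),((3 : ℤ) : ℚ)], (v ∈ order (-1) 3 ∨ v - ⟨1/2, 1/2, 1/2, -1/2⟩ ∈ order (-1) 3) ∧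
        v * star v = 1 ∧ moebius (rho (-1) 3 (by norm_num) (castQ (-1) 3 v)) p.1 = q.1)
      (fun p q : {τ : ℂ // 0 < τ.im ∧ ∃ x : ℍ[ℚ,((-1 : ℤ) : ℚ),((3 : ℤ) : ℚ)],
        x ∈ order (-1) 3 ∧ x.re = 0 ∧ (x * star x).re = t ∧ moebius (rho (-1) 3 (by norm_num) (castQ (-1) 3 x)) τ = τ} ↦
        ∃ g : ℍ[ℚ,((-1 : ℤ) : ℚ),((3 : ℤ) : ℚ)], g ≠ 0 ∧
        (∀ a : ℍ[ℚ,((-1 : ℤ) : ℚ),((3 : ℤ) : ℚ)], (a ∈ order (-1) 3 ∨ a - ⟨1/2, 1/2, 1/2, -1/2⟩ ∈ order (-1) 3) →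
          ∃ b : ℍ[ℚ,((-1 : ℤ) : ℚ),((3 : ℤ) : ℚ)], (b ∈ order (-1) 3 ∨ b - ⟨1/2, 1/2, 1/2, -1/2⟩ ∈ order (-1) 3) ∧
            g * a = b * g) ∧
        0 < (g * star g).re ∧ moebius (rho (-1) 3 (by norm_num) (castQ (-1) 3 g)) p.1 = q.1)
      (specialPointsPlus_rel_of_specialPoints_rel t) a = Quot.mk _ p} = 2) ∧
    ((∃ y : ℍ[ℚ,((-1 : ℤ) : ℚ),((3 : ℤ) : ℚ)], y ∈ order (-1) 3 ∧ y.re = 0 ∧ (y * star y).re = 3 ∧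
        moebius (rho (-1) 3 (by norm_num) (castQ (-1) 3 y)) p.1 = p.1) →
      Nat.card {a : Quot (fun p q : {τ : ℂ // 0 < τ.im ∧ ∃ x : ℍ[ℚ,((-1 : ℤ) : ℚ),((3 : ℤ) : ℚ)],
        x ∈ order (-1) 3 ∧ x.re = 0 ∧ (x * star x).re = t ∧ moebius (rho (-1) 3 (by norm_num) (castQ (-1) 3 x)) τ = τ} ↦
      ∃ v : ℍ[ℚ,((-1 : ℤ) : ℚ),((3 : ℤ) : ℚ)], (v ∈ order (-1) 3 ∨ v - ⟨1/2, 1/2, 1/2, -1/2⟩ ∈ order (-1) 3) ∧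
        v * star v = 1 ∧ moebius (rho (-1) 3 (by norm_num) (castQ (-1) 3 v)) p.1 = q.1) //
      Quot.factor
      (fun p q : {τ : ℂ // 0 < τ.im ∧ ∃ x : ℍ[ℚ,((-1 : ℤ) : ℚ),((3 : ℤ) : ℚ)],
        x ∈ order (-1) 3 ∧ x.re = 0 ∧ (x * star x).re = t ∧ moebius (rho (-1) 3 (by norm_num) (castQ (-1) 3 x)) τ = τ} ↦
        ∃ v : ℍ[ℚ,((-1 : ℤ) : ℚ),((3 : ℤ) : ℚ)], (v ∈ order (-1) 3 ∨ v - ⟨1/2, 1/2, 1/2, -1/2⟩ ∈ order (-1) 3) ∧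
        v * star v = 1 ∧ moebius (rho (-1) 3 (by norm_num) (castQ (-1) 3 v)) p.1 = q.1)
      (fun p q : {τ : ℂ // 0 < τ.im ∧ ∃ x : ℍ[ℚ,((-1 : ℤ) : ℚ),((3 : ℤ) : ℚ)],
        x ∈ order (-1) 3 ∧ x.re = 0 ∧ (x * star x).re = t ∧ moebius (rho (-1) 3 (by norm_num) (castQ (-1) 3 x)) τ = τ} ↦
        ∃ g : ℍ[ℚ,((-1 : ℤ) : ℚ),((3 : ℤ) : ℚ)], g ≠ 0 ∧
        (∀ a : ℍ[ℚ,((-1 : ℤ) : ℚ),((3 : ℤ) : ℚ)], (a ∈ order (-1) 3 ∨ a - ⟨1/2, 1/2, 1/2, -1/2⟩ ∈ order (-1) 3) →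
          ∃ b : ℍ[ℚ,((-1 : ℤ) : ℚ),((3 : ℤ) : ℚ)], (b ∈ order (-1) 3 ∨ b - ⟨1/2, 1/2, 1/2, -1/2⟩ ∈ order (-1) 3) ∧
            g * a = b * g) ∧
        0 < (g * star g).re ∧ moebius (rho (-1) 3 (by norm_num) (castQ (-1) 3 g)) p.1 = q.1)
      (specialPointsPlus_rel_of_specialPoints_rel t) a = Quot.mk _ p} = 2) ∧
    ((∃ y : ℍ[ℚ,((-1 : ℤ) : ℚ),((3 : ℤ) : ℚ)], y ∈ order (-1) 3 ∧ y.re = 0 ∧ (y * star y).re = 6 ∧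
        moebius (rho (-1) 3 (by norm_num) (castQ (-1) 3 y)) p.1 = p.1) →
      Nat.card {a : Quot (fun p q : {τ : ℂ // 0 < τ.im ∧ ∃ x : ℍ[ℚ,((-1 : ℤ) : ℚ),((3 : ℤ) : ℚ)],
        x ∈ order (-1) 3 ∧ x.re = 0 ∧ (x * star x).re = t ∧ moebius (rho (-1) 3 (by norm_num) (castQ (-1) 3 x)) τ = τ} ↦
      ∃ v : ℍ[ℚ,((-1 : ℤ) : ℚ),((3 : ℤ) : ℚ)], (v ∈ order (-1) 3 ∨ v - ⟨1/2, 1/2, 1/2, -1/2⟩ ∈ order (-1) 3) ∧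
        v * star v = 1 ∧ moebius (rho (-1) 3 (by norm_num) (castQ (-1) 3 v)) p.1 = q.1) //
      Quot.factor
      (fun p q : {τ : ℂ // 0 < τ.im ∧ ∃ x : ℍ[ℚ,((-1 : ℤ) : ℚ),((3 : ℤ) : ℚ)],
        x ∈ order (-1) 3 ∧ x.re = 0 ∧ (x * star x).re = t ∧ moebius (rho (-1) 3 (by norm_num) (castQ (-1) 3 x)) τ = τ} ↦
        ∃ v : ℍ[ℚ,((-1 : ℤ) : ℚ),((3 : ℤ) : ℚ)], (v ∈ order (-1) 3 ∨ v - ⟨1/2, 1/2, 1/2, -1/2⟩ ∈ order (-1) 3) ∧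
        v * star v = 1 ∧ moebius (rho (-1) 3 (by norm_num) (castQ (-1) 3 v)) p.1 = q.1)
      (fun p q : {τ : ℂ // 0 < τ.im ∧ ∃ x : ℍ[ℚ,((-1 : ℤ) : ℚ),((3 : ℤ) : ℚ)],
        x ∈ order (-1) 3 ∧ x.re = 0 ∧ (x * star x).re = t ∧ moebius (rho (-1) 3 (by norm_num) (castQ (-1) 3 x)) τ = τ} ↦
        ∃ g : ℍ[ℚ,((-1 : ℤ) : ℚ),((3 : ℤ) : ℚ)], g ≠ 0 ∧
        (∀ a : ℍ[ℚ,((-1 : ℤ) : ℚ),((3 : ℤ) : ℚ)], (a ∈ order (-1) 3 ∨ a - ⟨1/2, 1/2, 1/2, -1/2⟩ ∈ order (-1) 3) →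
          ∃ b : ℍ[ℚ,((-1 : ℤ) : ℚ),((3 : ℤ) : ℚ)], (b ∈ order (-1) 3 ∨ b - ⟨1/2, 1/2, 1/2, -1/2⟩ ∈ order (-1) 3) ∧
            g * a = b * g) ∧
        0 < (g * star g).re ∧ moebius (rho (-1) 3 (by norm_num) (castQ (-1) 3 g)) p.1 = q.1)
      (specialPointsPlus_rel_of_specialPoints_rel t) a = Quot.mk _ p} = 2) ∧
    (¬ (∃ y : ℍ[ℚ,((-1 : ℤ) : ℚ),((3 : ℤ) : ℚ)], y ∈ order (-1) 3 ∧ y.re = 0 ∧ (y * star y).re = 1 ∧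
        moebius (rho (-1) 3 (by norm_num) (castQ (-1) 3 y)) p.1 = p.1) →
      ¬ (∃ y : ℍ[ℚ,((-1 : ℤ) : ℚ),((3 : ℤ) : ℚ)], y ∈ order (-1) 3 ∧ y.re = 0 ∧ (y * star y).re = 3 ∧
        moebius (rho (-1) 3 (by norm_num) (castQ (-1) 3 y)) p.1 = p.1) →
      ¬ (∃ y : ℍ[ℚ,((-1 : ℤ) : ℚ),((3 : ℤ) : ℚ)], y ∈ order (-1) 3 ∧ y.re = 0 ∧ (y * star y).re = 6 ∧
        moebius (rho (-1) 3 (by norm_num) (castQ (-1) 3 y)) p.1 = p.1) →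
      Nat.card {a : Quot (fun p q : {τ : ℂ // 0 < τ.im ∧ ∃ x : ℍ[ℚ,((-1 : ℤ) : ℚ),((3 : ℤ) : ℚ)],
        x ∈ order (-1) 3 ∧ x.re = 0 ∧ (x * star x).re = t ∧ moebius (rho (-1) 3 (by norm_num) (castQ (-1) 3 x)) τ = τ} ↦
      ∃ v : ℍ[ℚ,((-1 : ℤ) : ℚ),((3 : ℤ) : ℚ)], (v ∈ order (-1) 3 ∨ v - ⟨1/2, 1/2, 1/2, -1/2⟩ ∈ order (-1) 3) ∧
        v * star v = 1 ∧ moebius (rho (-1) 3 (by norm_num) (castQ (-1) 3 v)) p.1 = q.1) //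
      Quot.factor
      (fun p q : {τ : ℂ // 0 < τ.im ∧ ∃ x : ℍ[ℚ,((-1 : ℤ) : ℚ),((3 : ℤ) : ℚ)],
        x ∈ order (-1) 3 ∧ x.re = 0 ∧ (x * star x).re = t ∧ moebius (rho (-1) 3 (by norm_num) (castQ (-1) 3 x)) τ = τ} ↦
        ∃ v : ℍ[ℚ,((-1 : ℤ) : ℚ),((3 : ℤ) : ℚ)], (v ∈ order (-1) 3 ∨ v - ⟨1/2, 1/2, 1/2, -1/2⟩ ∈ order (-1) 3) ∧
        v * star v = 1 ∧ moebius (rho (-1) 3 (by norm_num) (castQ (-1) 3 v)) p.1 = q.1)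
      (fun p q : {τ : ℂ // 0 < τ.im ∧ ∃ x : ℍ[ℚ,((-1 : ℤ) : ℚ),((3 : ℤ) : ℚ)],
        x ∈ order (-1) 3 ∧ x.re = 0 ∧ (x * star x).re = t ∧ moebius (rho (-1) 3 (by norm_num) (castQ (-1) 3 x)) τ = τ} ↦
        ∃ g : ℍ[ℚ,((-1 : ℤ) : ℚ),((3 : ℤ) : ℚ)], g ≠ 0 ∧
        (∀ a : ℍ[ℚ,((-1 : ℤ) : ℚ),((3 : ℤ) : ℚ)], (a ∈ order (-1) 3 ∨ a - ⟨1/2, 1/2, 1/2, -1/2⟩ ∈ order (-1) 3) →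
          ∃ b : ℍ[ℚ,((-1 : ℤ) : ℚ),((3 : ℤ) : ℚ)], (b ∈ order (-1) 3 ∨ b - ⟨1/2, 1/2, 1/2, -1/2⟩ ∈ order (-1) 3) ∧
            g * a = b * g) ∧
        0 < (g * star g).re ∧ moebius (rho (-1) 3 (by norm_num) (castQ (-1) 3 g)) p.1 = q.1)
      (specialPointsPlus_rel_of_specialPoints_rel t) a = Quot.mk _ p} = 4) := by
  set S : {τ : ℂ // 0 < τ.im ∧ ∃ x : ℍ[ℚ,((-1 : ℤ) : ℚ),((3 : ℤ) : ℚ)],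
        x ∈ order (-1) 3 ∧ x.re = 0 ∧ (x * star x).re = t ∧ moebius (rho (-1) 3 (by norm_num) (castQ (-1) 3 x)) τ = τ} →
      {τ : ℂ // 0 < τ.im ∧ ∃ x : ℍ[ℚ,((-1 : ℤ) : ℚ),((3 : ℤ) : ℚ)],
        x ∈ order (-1) 3 ∧ x.re = 0 ∧ (x * star x).re = t ∧ moebius (rho (-1) 3 (by norm_num) (castQ (-1) 3 x)) τ = τ} → Prop :=
    fun p q ↦ ∃ v : ℍ[ℚ,((-1 : ℤ) : ℚ),((3 : ℤ) : ℚ)], (v ∈ order (-1) 3 ∨ v - ⟨1/2, 1/2, 1/2, -1/2⟩ ∈ order (-1) 3) ∧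
        v * star v = 1 ∧ moebius (rho (-1) 3 (by norm_num) (castQ (-1) 3 v)) p.1 = q.1 with hS
  set P : {τ : ℂ // 0 < τ.im ∧ ∃ x : ℍ[ℚ,((-1 : ℤ) : ℚ),((3 : ℤ) : ℚ)],
        x ∈ order (-1) 3 ∧ x.re = 0 ∧ (x * star x).re = t ∧ moebius (rho (-1) 3 (by norm_num) (castQ (-1) 3 x)) τ = τ} →
      {τ : ℂ // 0 < τ.im ∧ ∃ x : ℍ[ℚ,((-1 : ℤ) : ℚ),((3 : ℤ) : ℚ)],
        x ∈ order (-1) 3 ∧ x.re = 0 ∧ (x * star x).re = t ∧ moebius (rho (-1) 3 (by norm_num) (castQ (-1) 3 x)) τ = τ} → Prop :=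
    fun p q ↦ ∃ g : ℍ[ℚ,((-1 : ℤ) : ℚ),((3 : ℤ) : ℚ)], g ≠ 0 ∧
        (∀ a : ℍ[ℚ,((-1 : ℤ) : ℚ),((3 : ℤ) : ℚ)], (a ∈ order (-1) 3 ∨ a - ⟨1/2, 1/2, 1/2, -1/2⟩ ∈ order (-1) 3) →
          ∃ b : ℍ[ℚ,((-1 : ℤ) : ℚ),((3 : ℤ) : ℚ)], (b ∈ order (-1) 3 ∨ b - ⟨1/2, 1/2, 1/2, -1/2⟩ ∈ order (-1) 3) ∧
            g * a = b * g) ∧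
        0 < (g * star g).re ∧ moebius (rho (-1) 3 (by norm_num) (castQ (-1) 3 g)) p.1 = q.1 with hP
  have hE : Equivalence S := specialPoints_equivalence t
  have hEP : Equivalence P := specialPointsPlus_equivalence t
  have hiff : ∀ p q, Quot.mk S p = Quot.mk S q ↔ S p q := specialPoints_mk_eq_iff t
  have hiffP : ∀ p q, Quot.mk P p = Quot.mk P q ↔ P p q := specialPointsPlus_mk_eq_iff t
  have h3' : (0 : ℤ) < 3 := by norm_num
  -- the two generators `μ` (for `A`) and `w₂` (for `M`): norms, normalising data
  have h1O : ((1 : ℍ[ℚ,((-1 : ℤ) : ℚ),((3 : ℤ) : ℚ)]) ∈ order (-1) 3 ∨ (1 : ℍ[ℚ,((-1 : ℤ) : ℚ),((3 : ℤ) : ℚ)]) - ⟨1/2, 1/2, 1/2, -1/2⟩ ∈ order (-1) 3) := Or.inl (Subring.one_mem _)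
  have h11 : (1 : ℍ[ℚ,((-1 : ℤ) : ℚ),((3 : ℤ) : ℚ)]) * star 1 = 1 ∨ (1 : ℍ[ℚ,((-1 : ℤ) : ℚ),((3 : ℤ) : ℚ)]) * star 1 = -1 := Or.inl (by rw [star_one, mul_one])
  have hNm := normalises_of_eq_smul_unit_mul_atkinLehner (g := ⟨3, 0, 1, 1⟩) (q := 1) h1O h11 0 1
    (by rw [pow_zero, pow_one, one_mul, one_mul, one_smul])
  have hNw := normalises_of_eq_smul_unit_mul_atkinLehner (g := ⟨1, 1, 0, 0⟩) (q := 1) h1O h11 1 0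
    (by rw [pow_one, pow_zero, mul_one, one_mul, one_smul])
  have hnm : ((⟨3, 0, 1, 1⟩ : ℍ[ℚ,((-1 : ℤ) : ℚ),((3 : ℤ) : ℚ)]) * star ⟨3, 0, 1, 1⟩).re = 3 := by
    rw [QuaternionAlgebra.star_mk, QuaternionAlgebra.mk_mul_mk]; norm_num
  have hnw : ((⟨1, 1, 0, 0⟩ : ℍ[ℚ,((-1 : ℤ) : ℚ),((3 : ℤ) : ℚ)]) * star ⟨1, 1, 0, 0⟩).re = 2 := by
    rw [QuaternionAlgebra.star_mk, QuaternionAlgebra.mk_mul_mk]; norm_num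
  have hm0 : (⟨3, 0, 1, 1⟩ : ℍ[ℚ,((-1 : ℤ) : ℚ),((3 : ℤ) : ℚ)]) ≠ 0 := fun h ↦ by simpa using congrArg QuaternionAlgebra.re h
  have hw0 : (⟨1, 1, 0, 0⟩ : ℍ[ℚ,((-1 : ℤ) : ℚ),((3 : ℤ) : ℚ)]) ≠ 0 := fun h ↦ by simpa using congrArg QuaternionAlgebra.re h
  -- the maps on points
  have memA : ∀ p : {τ : ℂ // 0 < τ.im ∧ ∃ x : ℍ[ℚ,((-1 : ℤ) : ℚ),((3 : ℤ) : ℚ)],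
        x ∈ order (-1) 3 ∧ x.re = 0 ∧ (x * star x).re = t ∧ moebius (rho (-1) 3 (by norm_num) (castQ (-1) 3 x)) τ = τ}, 0 < (moebius (rho (-1) 3 (by norm_num) (castQ (-1) 3 (⟨3, 0, 1, 1⟩ : ℍ[ℚ,((-1 : ℤ) : ℚ),((3 : ℤ) : ℚ)]))) p.1).im ∧
      ∃ y : ℍ[ℚ,((-1 : ℤ) : ℚ),((3 : ℤ) : ℚ)], y ∈ order (-1) 3 ∧ y.re = 0 ∧ (y * star y).re = t ∧
        moebius (rho (-1) 3 (by norm_num) (castQ (-1) 3 y)) (moebius (rho (-1) 3 (by norm_num) (castQ (-1) 3 (⟨3, 0, 1, 1⟩ : ℍ[ℚ,((-1 : ℤ) : ℚ),((3 : ℤ) : ℚ)]))) p.1) = moebius (rho (-1) 3 (by norm_num) (castQ (-1) 3 (⟨3, 0, 1, 1⟩ : ℍ[ℚ,((-1 : ℤ) : ℚ),((3 : ℤ) : ℚ)]))) p.1 := by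
    intro p
    obtain ⟨x, hx, hre, hxn, hfix⟩ := p.2.2
    exact moebius_mem_specialPoints₁₇ hnm three_pos hNm.1.1 p.2.1 hx hre hxn hfix
  have memM : ∀ p : {τ : ℂ // 0 < τ.im ∧ ∃ x : ℍ[ℚ,((-1 : ℤ) : ℚ),((3 : ℤ) : ℚ)],
        x ∈ order (-1) 3 ∧ x.re = 0 ∧ (x * star x).re = t ∧ moebius (rho (-1) 3 (by norm_num) (castQ (-1) 3 x)) τ = τ}, 0 < (moebius (rho (-1) 3 (by norm_num) (castQ (-1) 3 (⟨1, 1, 0, 0⟩ : ℍ[ℚ,((-1 : ℤ) : ℚ),((3 : ℤ) : ℚ)]))) p.1).im ∧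
      ∃ y : ℍ[ℚ,((-1 : ℤ) : ℚ),((3 : ℤ) : ℚ)], y ∈ order (-1) 3 ∧ y.re = 0 ∧ (y * star y).re = t ∧
        moebius (rho (-1) 3 (by norm_num) (castQ (-1) 3 y)) (moebius (rho (-1) 3 (by norm_num) (castQ (-1) 3 (⟨1, 1, 0, 0⟩ : ℍ[ℚ,((-1 : ℤ) : ℚ),((3 : ℤ) : ℚ)]))) p.1) = moebius (rho (-1) 3 (by norm_num) (castQ (-1) 3 (⟨1, 1, 0, 0⟩ : ℍ[ℚ,((-1 : ℤ) : ℚ),((3 : ℤ) : ℚ)]))) p.1 := by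
    intro p
    obtain ⟨x, hx, hre, hxn, hfix⟩ := p.2.2
    exact moebius_mem_specialPoints₁₇ hnw two_pos hNw.1.1 p.2.1 hx hre hxn hfix
  set aA : {τ : ℂ // 0 < τ.im ∧ ∃ x : ℍ[ℚ,((-1 : ℤ) : ℚ),((3 : ℤ) : ℚ)],
        x ∈ order (-1) 3 ∧ x.re = 0 ∧ (x * star x).re = t ∧ moebius (rho (-1) 3 (by norm_num) (castQ (-1) 3 x)) τ = τ} →
      {τ : ℂ // 0 < τ.im ∧ ∃ x : ℍ[ℚ,((-1 : ℤ) : ℚ),((3 : ℤ) : ℚ)],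
        x ∈ order (-1) 3 ∧ x.re = 0 ∧ (x * star x).re = t ∧ moebius (rho (-1) 3 (by norm_num) (castQ (-1) 3 x)) τ = τ} :=
    fun p ↦ ⟨moebius (rho (-1) 3 (by norm_num) (castQ (-1) 3 (⟨3, 0, 1, 1⟩ : ℍ[ℚ,((-1 : ℤ) : ℚ),((3 : ℤ) : ℚ)]))) p.1, memA p⟩ with haA
  set aM : {τ : ℂ // 0 < τ.im ∧ ∃ x : ℍ[ℚ,((-1 : ℤ) : ℚ),((3 : ℤ) : ℚ)],
        x ∈ order (-1) 3 ∧ x.re = 0 ∧ (x * star x).re = t ∧ moebius (rho (-1) 3 (by norm_num) (castQ (-1) 3 x)) τ = τ} →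
      {τ : ℂ // 0 < τ.im ∧ ∃ x : ℍ[ℚ,((-1 : ℤ) : ℚ),((3 : ℤ) : ℚ)],
        x ∈ order (-1) 3 ∧ x.re = 0 ∧ (x * star x).re = t ∧ moebius (rho (-1) 3 (by norm_num) (castQ (-1) 3 x)) τ = τ} :=
    fun p ↦ ⟨moebius (rho (-1) 3 (by norm_num) (castQ (-1) 3 (⟨1, 1, 0, 0⟩ : ℍ[ℚ,((-1 : ℤ) : ℚ),((3 : ℤ) : ℚ)]))) p.1, memM p⟩ with haM
  -- compatibility with `Γ₆`-equivalence: `ρ(W)ρ(v) = ρ(v′)ρ(W)`, `Wv = v′W`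
  have compat : ∀ (W : ℍ[ℚ,((-1 : ℤ) : ℚ),((3 : ℤ) : ℚ)]) (aW : {τ : ℂ // 0 < τ.im ∧ ∃ x : ℍ[ℚ,((-1 : ℤ) : ℚ),((3 : ℤ) : ℚ)],
        x ∈ order (-1) 3 ∧ x.re = 0 ∧ (x * star x).re = t ∧ moebius (rho (-1) 3 (by norm_num) (castQ (-1) 3 x)) τ = τ} →
      {τ : ℂ // 0 < τ.im ∧ ∃ x : ℍ[ℚ,((-1 : ℤ) : ℚ),((3 : ℤ) : ℚ)],
        x ∈ order (-1) 3 ∧ x.re = 0 ∧ (x * star x).re = t ∧ moebius (rho (-1) 3 (by norm_num) (castQ (-1) 3 x)) τ = τ}),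
      0 < (W * star W).re →
      (∀ a : ℍ[ℚ,((-1 : ℤ) : ℚ),((3 : ℤ) : ℚ)], (a ∈ order (-1) 3 ∨ a - ⟨1/2, 1/2, 1/2, -1/2⟩ ∈ order (-1) 3) →
        ∃ b : ℍ[ℚ,((-1 : ℤ) : ℚ),((3 : ℤ) : ℚ)], (b ∈ order (-1) 3 ∨ b - ⟨1/2, 1/2, 1/2, -1/2⟩ ∈ order (-1) 3) ∧ W * a = b * W) →
      (∀ p, (aW p).1 = moebius (rho (-1) 3 (by norm_num) (castQ (-1) 3 W)) p.1) →
      ∀ p q, S p q → S (aW p) (aW q) := by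
    intro W aW hWpos hL haWp p q
    rintro ⟨v, hv, hv1, h⟩
    obtain ⟨v', hv', e⟩ := hL v hv
    have hvn : (v * star v).re = 1 := by rw [hv1, QuaternionAlgebra.re_one]
    have hv'n : (v' * star v').re = 1 := by
      have e2 := re_mul_mul_star_mul W v
      have e3 := re_mul_mul_star_mul v' W
      rw [e, hvn, mul_one] at e2
      rw [e2] at e3
      have e4 : (1 : ℚ) * (W * star W).re = (v' * star v').re * (W * star W).re := by rw [one_mul]; exact e3
      exact (mul_right_cancel₀ hWpos.ne' e4).symm
    refine ⟨v', hv', mul_star_eq_one_of_re hv'n, ?_⟩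
    rw [haWp, haWp, ← moebius_rho_castQ_mul₁₇ hWpos (by rw [hv'n]; exact one_pos) p.2.1, ← e,
      moebius_rho_castQ_mul₁₇ (by rw [hvn]; exact one_pos) hWpos p.2.1, h]
  have cA : ∀ p q, S p q → S (aA p) (aA q) := compat ⟨3, 0, 1, 1⟩ aA (by rw [hnm]; norm_num) hNm.2.1 (fun _ ↦ rfl)
  have cM : ∀ p q, S p q → S (aM p) (aM q) := compat ⟨1, 1, 0, 0⟩ aM (by rw [hnw]; norm_num) hNw.2.1 (fun _ ↦ rfl)
  -- the Klein four-group data for `ν = M`, `π = A`, `f` the projection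
  have hSP : ∀ p q, S p q → P p q := specialPointsPlus_rel_of_specialPoints_rel t
  have hMM : ∀ q : Quot S, Quot.map aM cM (Quot.map aM cM q) = q := by
    -- `M² = 1`: `ρ(w₂)² = ρ(2i) = ρ(i)`, `i ∈ Γ₆`
    intro q
    induction q using Quot.ind with
    | _ p =>
      show Quot.mk S (aM (aM p)) = Quot.mk S p
      rw [hiff]
      refine ⟨star ⟨0, 1, 0, 0⟩, star_maxOrder (Or.inl ⟨![0, 1, 0, 0], by ext <;> simp [ofCoords]⟩),
        by rw [star_star, QuaternionAlgebra.star_mk, QuaternionAlgebra.mk_mul_mk]; ext <;> norm_num, ?_⟩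
      show moebius (rho (-1) 3 (by norm_num) (castQ (-1) 3 (star (⟨0, 1, 0, 0⟩ : ℍ[ℚ,((-1 : ℤ) : ℚ),((3 : ℤ) : ℚ)]))))
        (moebius (rho (-1) 3 (by norm_num) (castQ (-1) 3 (⟨1, 1, 0, 0⟩ : ℍ[ℚ,((-1 : ℤ) : ℚ),((3 : ℤ) : ℚ)]))) (moebius (rho (-1) 3 (by norm_num) (castQ (-1) 3 (⟨1, 1, 0, 0⟩ : ℍ[ℚ,((-1 : ℤ) : ℚ),((3 : ℤ) : ℚ)]))) p.1)) = p.1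
      have hsq : (⟨1, 1, 0, 0⟩ : ℍ[ℚ,((-1 : ℤ) : ℚ),((3 : ℤ) : ℚ)]) * ⟨1, 1, 0, 0⟩ = (2 : ℚ) • ⟨0, 1, 0, 0⟩ := by
        rw [QuaternionAlgebra.mk_mul_mk, QuaternionAlgebra.smul_mk]; ext <;> norm_num
      have hi : 0 < ((⟨0, 1, 0, 0⟩ : ℍ[ℚ,((-1 : ℤ) : ℚ),((3 : ℤ) : ℚ)]) * star ⟨0, 1, 0, 0⟩).re := by
        rw [QuaternionAlgebra.star_mk, QuaternionAlgebra.mk_mul_mk]; norm_num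
      rw [← moebius_rho_castQ_mul₁₇ (by rw [hnw]; norm_num) (by rw [hnw]; norm_num) p.2.1, hsq,
        moebius_rho_castQ_smul (by norm_num : (2 : ℚ) ≠ 0)]
      exact moebius_rho_star_moebius_rho h3' hi (UpperHalfPlane.mk p.1 p.2.1)
  have hAA : ∀ q : Quot S, Quot.map aA cA (Quot.map aA cA q) = q := by
    -- `A² = 1`: `μ² = 3·u`, `u = 5 + 2j + 2ij ∈ Γ₆`
    intro q
    induction q using Quot.ind with
    | _ p =>
      show Quot.mk S (aA (aA p)) = Quot.mk S p
      rw [hiff]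
      refine ⟨star ⟨5, 0, 2, 2⟩, star_maxOrder (Or.inl ⟨![5, 0, 2, 2], by ext <;> simp [ofCoords]⟩),
        by rw [star_star, QuaternionAlgebra.star_mk, QuaternionAlgebra.mk_mul_mk]; ext <;> norm_num, ?_⟩
      show moebius (rho (-1) 3 (by norm_num) (castQ (-1) 3 (star (⟨5, 0, 2, 2⟩ : ℍ[ℚ,((-1 : ℤ) : ℚ),((3 : ℤ) : ℚ)]))))
        (moebius (rho (-1) 3 (by norm_num) (castQ (-1) 3 (⟨3, 0, 1, 1⟩ : ℍ[ℚ,((-1 : ℤ) : ℚ),((3 : ℤ) : ℚ)]))) (moebius (rho (-1) 3 (by norm_num) (castQ (-1) 3 (⟨3, 0, 1, 1⟩ : ℍ[ℚ,((-1 : ℤ) : ℚ),((3 : ℤ) : ℚ)]))) p.1)) = p.1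
      have hsq : (⟨3, 0, 1, 1⟩ : ℍ[ℚ,((-1 : ℤ) : ℚ),((3 : ℤ) : ℚ)]) * ⟨3, 0, 1, 1⟩ = (3 : ℚ) • ⟨5, 0, 2, 2⟩ := by
        rw [QuaternionAlgebra.mk_mul_mk, QuaternionAlgebra.smul_mk]; ext <;> norm_num
      have hu : 0 < ((⟨5, 0, 2, 2⟩ : ℍ[ℚ,((-1 : ℤ) : ℚ),((3 : ℤ) : ℚ)]) * star ⟨5, 0, 2, 2⟩).re := by
        rw [QuaternionAlgebra.star_mk, QuaternionAlgebra.mk_mul_mk]; norm_num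
      rw [← moebius_rho_castQ_mul₁₇ (by rw [hnm]; norm_num) (by rw [hnm]; norm_num) p.2.1, hsq,
        moebius_rho_castQ_smul (by norm_num : (3 : ℚ) ≠ 0)]
      exact moebius_rho_star_moebius_rho h3' hu (UpperHalfPlane.mk p.1 p.2.1)
  have hc : ∀ q : Quot S, Quot.map aA cA (Quot.map aM cM q) = Quot.map aM cM (Quot.map aA cA q) := by
    -- `AM = MA`: `μw₂ = v₀·(w₂μ)` with `v₀ = 3 + 2i + 2j ∈ Γ₆`
    intro q
    induction q using Quot.ind with
    | _ p =>
      show Quot.mk S (aA (aM p)) = Quot.mk S (aM (aA p))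
      rw [hiff]
      apply hE.symm
      refine ⟨⟨3, 2, 2, 0⟩, Or.inl ⟨![3, 2, 2, 0], by ext <;> simp [ofCoords]⟩,
        by rw [QuaternionAlgebra.star_mk, QuaternionAlgebra.mk_mul_mk]; ext <;> norm_num, ?_⟩
      show moebius (rho (-1) 3 (by norm_num) (castQ (-1) 3 (⟨3, 2, 2, 0⟩ : ℍ[ℚ,((-1 : ℤ) : ℚ),((3 : ℤ) : ℚ)])))
        (moebius (rho (-1) 3 (by norm_num) (castQ (-1) 3 (⟨1, 1, 0, 0⟩ : ℍ[ℚ,((-1 : ℤ) : ℚ),((3 : ℤ) : ℚ)]))) (moebius (rho (-1) 3 (by norm_num) (castQ (-1) 3 (⟨3, 0, 1, 1⟩ : ℍ[ℚ,((-1 : ℤ) : ℚ),((3 : ℤ) : ℚ)]))) p.1)) = moebius (rho (-1) 3 (by norm_num) (castQ (-1) 3 (⟨3, 0, 1, 1⟩ : ℍ[ℚ,((-1 : ℤ) : ℚ),((3 : ℤ) : ℚ)]))) (moebius (rho (-1) 3 (by norm_num) (castQ (-1) 3 (⟨1, 1, 0, 0⟩ : ℍ[ℚ,((-1 : ℤ)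 : ℚ),((3 : ℤ) : ℚ)]))) p.1)
      have hv0 : 0 < ((⟨3, 2, 2, 0⟩ : ℍ[ℚ,((-1 : ℤ) : ℚ),((3 : ℤ) : ℚ)]) * star ⟨3, 2, 2, 0⟩).re := by
        rw [QuaternionAlgebra.star_mk, QuaternionAlgebra.mk_mul_mk]; norm_num
      have hn6 : 0 < (((⟨1, 1, 0, 0⟩ : ℍ[ℚ,((-1 : ℤ) : ℚ),((3 : ℤ) : ℚ)]) * ⟨3, 0, 1, 1⟩) * star ((⟨1, 1, 0, 0⟩ : ℍ[ℚ,((-1 : ℤ) : ℚ),((3 : ℤ) : ℚ)]) * ⟨3, 0, 1, 1⟩)).re := by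
        rw [re_mul_mul_star_mul, hnw, hnm]; norm_num
      have hrel : (⟨3, 2, 2, 0⟩ : ℍ[ℚ,((-1 : ℤ) : ℚ),((3 : ℤ) : ℚ)]) * (⟨1, 1, 0, 0⟩ * ⟨3, 0, 1, 1⟩) = ⟨3, 0, 1, 1⟩ * ⟨1, 1, 0, 0⟩ := by
        rw [QuaternionAlgebra.mk_mul_mk, QuaternionAlgebra.mk_mul_mk, QuaternionAlgebra.mk_mul_mk]; ext <;> norm_num
      rw [← moebius_rho_castQ_mul₁₇ (by rw [hnm]; norm_num) (by rw [hnw]; norm_num) p.2.1,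
        ← moebius_rho_castQ_mul₁₇ hn6 hv0 p.2.1, hrel,
        moebius_rho_castQ_mul₁₇ (by rw [hnw]; norm_num) (by rw [hnm]; norm_num) p.2.1]
  have hfM : ∀ q : Quot S, Quot.factor S P hSP (Quot.map aM cM q) = Quot.factor S P hSP q := by
    intro q
    induction q using Quot.ind with
    | _ p =>
      show Quot.mk P (aM p) = Quot.mk P p
      exact ((hiffP p (aM p)).2 ⟨⟨1, 1, 0, 0⟩, hw0, hNw.2.1, by rw [hnw]; norm_num, rfl⟩).symm
  have hfA : ∀ q : Quot S, Quot.factor S P hSP (Quot.map aA cA q) = Quot.factor S P hSP q := by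
    intro q
    induction q using Quot.ind with
    | _ p =>
      show Quot.mk P (aA p) = Quot.mk P p
      exact ((hiffP p (aA p)).2 ⟨⟨3, 0, 1, 1⟩, hm0, hNm.2.1, by rw [hnm]; norm_num, rfl⟩).symm
  have hff : ∀ q₁ q₂ : Quot S, Quot.factor S P hSP q₁ = Quot.factor S P hSP q₂ →
      q₁ = q₂ ∨ q₁ = Quot.map aM cM q₂ ∨ q₁ = Quot.map aA cA q₂ ∨ q₁ = Quot.map aM cM (Quot.map aA cA q₂) := by
    -- fibres: `Γ₆⁺ = ℚ_{>0}·Γ₆·{1, w₂, μ, w₂μ}`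
    intro q₁ q₂
    induction q₁ using Quot.ind with
    | _ p₁ =>
      induction q₂ using Quot.ind with
      | _ p₂ =>
        intro h
        change Quot.mk P p₁ = Quot.mk P p₂ at h
        rw [hiffP] at h
        obtain ⟨g, hg0, hL, hgn, hg⟩ := hEP.symm h
        obtain ⟨q, v, k, l, hq, hv, h1, hk, hl, rfl⟩ := (normalises_maxOrder_iff_exists' hg0).1 hL
        have hWn := norm_atkinLehner_word₁₇ k l hk hl
        have hWpos : 0 < (((⟨1, 1, 0, 0⟩ : ℍ[ℚ,((-1 : ℤ) : ℚ),((3 : ℤ) : ℚ)]) ^ k * ⟨3, 0, 1, 1⟩ ^ l) * star ((⟨1, 1, 0, 0⟩ : ℍ[ℚ,((-1 : ℤ) : ℚ),((3 : ℤ) : ℚ)]) ^ k * ⟨3, 0, 1, 1⟩ ^ l)).re := by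
          rw [hWn]; positivity
        have hv1 : v * star v = 1 := by
          rcases h1 with h1 | h1
          · exact h1
          · exfalso
            have e1 : (q • (v * ⟨1, 1, 0, 0⟩ ^ k * ⟨3, 0, 1, 1⟩ ^ l) *
                star (q • (v * ⟨1, 1, 0, 0⟩ ^ k * ⟨3, 0, 1, 1⟩ ^ l))).re =
                q ^ 2 * ((v * star v).re * ((((⟨1, 1, 0, 0⟩ : ℍ[ℚ,((-1 : ℤ) : ℚ),((3 : ℤ) : ℚ)])) ^ k * ⟨3, 0, 1, 1⟩ ^ l) *
                  star (((⟨1, 1, 0, 0⟩ : ℍ[ℚ,((-1 : ℤ) : ℚ),((3 : ℤ) : ℚ)])) ^ k * ⟨3, 0, 1, 1⟩ ^ l)).re) := by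
              rw [QuaternionAlgebra.star_smul, smul_mul_assoc, mul_smul_comm, ← mul_smul, QuaternionAlgebra.re_smul,
                smul_eq_mul, mul_assoc v, re_mul_mul_star_mul, pow_two]
            rw [e1, h1, QuaternionAlgebra.re_neg, QuaternionAlgebra.re_one] at hgn
            nlinarith [sq_nonneg q, mul_pos (pow_pos hq 2) hWpos]
        have hvn : (v * star v).re = 1 := by rw [hv1, QuaternionAlgebra.re_one]
        have hgW : moebius (rho (-1) 3 (by norm_num) (castQ (-1) 3 (q • (v * ⟨1, 1, 0, 0⟩ ^ k * ⟨3, 0, 1, 1⟩ ^ l)))) p₂.1 =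
            moebius (rho (-1) 3 (by norm_num) (castQ (-1) 3 v))
              (moebius (rho (-1) 3 (by norm_num) (castQ (-1) 3 ((⟨1, 1, 0, 0⟩ : ℍ[ℚ,((-1 : ℤ) : ℚ),((3 : ℤ) : ℚ)]) ^ k * ⟨3, 0, 1, 1⟩ ^ l))) p₂.1) := by
          rw [moebius_rho_castQ_smul hq.ne', mul_assoc, moebius_rho_castQ_mul₁₇ hWpos (by rw [hvn]; exact one_pos) p₂.2.1]
        rw [hgW] at hg
        rcases Nat.le_one_iff_eq_zero_or_eq_one.1 hk with rfl | rfl <;>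
          rcases Nat.le_one_iff_eq_zero_or_eq_one.1 hl with rfl | rfl
        · left
          rw [hiff]
          refine hE.symm ⟨v, hv, hv1, ?_⟩
          rw [pow_zero, pow_zero, mul_one, moebius_rho_castQ_one₁₇] at hg
          exact hg
        · right; right; left
          show Quot.mk S p₁ = Quot.mk S (aA p₂)
          rw [hiff]
          refine hE.symm ⟨v, hv, hv1, ?_⟩
          rw [pow_zero, pow_one, one_mul] at hg
          exact hg
        · right; left
          show Quot.mk S p₁ = Quot.mk S (aM p₂)
          rw [hiff]
          refine hE.symm ⟨v, hv, hv1, ?_⟩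
          rw [pow_one, pow_zero, mul_one] at hg
          exact hg
        · right; right; right
          show Quot.mk S p₁ = Quot.mk S (aM (aA p₂))
          rw [hiff]
          refine hE.symm ⟨v, hv, hv1, ?_⟩
          rw [pow_one, pow_one, moebius_rho_castQ_mul₁₇ (by rw [hnm]; norm_num) (by rw [hnw]; norm_num) p₂.2.1] at hg
          exact hg
  -- fixed classes of `M`, `A`, `MA` at `[p]` ⟺ `p ∈ Pt(1)`, `Pt(3)`, `Pt(6)`
  have fixM : Quot.map aM cM (Quot.mk S p) = Quot.mk S p ↔
      ∃ y : ℍ[ℚ,((-1 : ℤ) : ℚ),((3 : ℤ) : ℚ)], y ∈ order (-1) 3 ∧ y.re = 0 ∧ (y * star y).re = 1 ∧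
        moebius (rho (-1) 3 (by norm_num) (castQ (-1) 3 y)) p.1 = p.1 := by
    show Quot.mk S (aM p) = Quot.mk S p ↔ _
    rw [hiff]
    exact normOne_moebius_w2_fixed_iff p.2.1
  have fixA : Quot.map aA cA (Quot.mk S p) = Quot.mk S p ↔
      ∃ y : ℍ[ℚ,((-1 : ℤ) : ℚ),((3 : ℤ) : ℚ)], y ∈ order (-1) 3 ∧ y.re = 0 ∧ (y * star y).re = 3 ∧
        moebius (rho (-1) 3 (by norm_num) (castQ (-1) 3 y)) p.1 = p.1 := by
    show Quot.mk S (aA p) = Quot.mk S p ↔ _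
    rw [hiff]
    exact normOne_moebius_mu_fixed_iff p.2.1
  have fixMA : Quot.map aM cM (Quot.map aA cA (Quot.mk S p)) = Quot.mk S p ↔
      ∃ y : ℍ[ℚ,((-1 : ℤ) : ℚ),((3 : ℤ) : ℚ)], y ∈ order (-1) 3 ∧ y.re = 0 ∧ (y * star y).re = 6 ∧
        moebius (rho (-1) 3 (by norm_num) (castQ (-1) 3 y)) p.1 = p.1 := by
    show Quot.mk S (aM (aA p)) = Quot.mk S p ↔ _
    rw [hiff]
    exact normOne_moebius_w2_mu_fixed_iff p.2.1
  -- `Pt(1)`, `Pt(3)`, `Pt(6)` are pairwise disjoint (commensurability)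
  have ex13 : (∃ y : ℍ[ℚ,((-1 : ℤ) : ℚ),((3 : ℤ) : ℚ)], y ∈ order (-1) 3 ∧ y.re = 0 ∧ (y * star y).re = 1 ∧
        moebius (rho (-1) 3 (by norm_num) (castQ (-1) 3 y)) p.1 = p.1) →
      ¬ (∃ y : ℍ[ℚ,((-1 : ℤ) : ℚ),((3 : ℤ) : ℚ)], y ∈ order (-1) 3 ∧ y.re = 0 ∧ (y * star y).re = 3 ∧
        moebius (rho (-1) 3 (by norm_num) (castQ (-1) 3 y)) p.1 = p.1) := by
    rintro ⟨x, -, hxre, hxn, hfx⟩ ⟨y, -, hyre, hyn, hfy⟩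
    obtain ⟨c, hc⟩ := exists_sq_mul_of_specialPoints_inter p.2.1.ne' hxre hyre hxn hyn three_pos hfx hfy
    exact not_one_eq_sq_mul_three₁₇ hc
  have ex16 : (∃ y : ℍ[ℚ,((-1 : ℤ) : ℚ),((3 : ℤ) : ℚ)], y ∈ order (-1) 3 ∧ y.re = 0 ∧ (y * star y).re = 1 ∧
        moebius (rho (-1) 3 (by norm_num) (castQ (-1) 3 y)) p.1 = p.1) →
      ¬ (∃ y : ℍ[ℚ,((-1 : ℤ) : ℚ),((3 : ℤ) : ℚ)], y ∈ order (-1) 3 ∧ y.re = 0 ∧ (y * star y).re = 6 ∧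
        moebius (rho (-1) 3 (by norm_num) (castQ (-1) 3 y)) p.1 = p.1) := by
    rintro ⟨x, -, hxre, hxn, hfx⟩ ⟨y, -, hyre, hyn, hfy⟩
    obtain ⟨c, hc⟩ := exists_sq_mul_of_specialPoints_inter p.2.1.ne' hxre hyre hxn hyn (by norm_num) hfx hfy
    exact not_one_eq_sq_mul_six₁₇ hc
  have ex36 : (∃ y : ℍ[ℚ,((-1 : ℤ) : ℚ),((3 : ℤ) : ℚ)], y ∈ order (-1) 3 ∧ y.re = 0 ∧ (y * star y).re = 3 ∧
        moebius (rho (-1) 3 (by norm_num) (castQ (-1) 3 y)) p.1 = p.1) →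
      ¬ (∃ y : ℍ[ℚ,((-1 : ℤ) : ℚ),((3 : ℤ) : ℚ)], y ∈ order (-1) 3 ∧ y.re = 0 ∧ (y * star y).re = 6 ∧
        moebius (rho (-1) 3 (by norm_num) (castQ (-1) 3 y)) p.1 = p.1) := by
    rintro ⟨x, -, hxre, hxn, hfx⟩ ⟨y, -, hyre, hyn, hfy⟩
    obtain ⟨c, hc⟩ := exists_sq_mul_of_specialPoints_inter p.2.1.ne' hxre hyre hxn hyn (by norm_num) hfx hfy
    exact not_three_eq_sq_mul_six₁₇ hc
  -- the fibre of the statement is the fibre of `f` at `[p]`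
  change (_ → Nat.card {a : Quot S // Quot.factor S P hSP a = Quot.factor S P hSP (Quot.mk S p)} = 2) ∧
    (_ → Nat.card {a : Quot S // Quot.factor S P hSP a = Quot.factor S P hSP (Quot.mk S p)} = 2) ∧
    (_ → Nat.card {a : Quot S // Quot.factor S P hSP a = Quot.factor S P hSP (Quot.mk S p)} = 2) ∧
    (_ → _ → _ → Nat.card {a : Quot S // Quot.factor S P hSP a = Quot.factor S P hSP (Quot.mk S p)} = 4)
  refine ⟨fun h1 ↦ ?_, fun h3 ↦ ?_, fun h6 ↦ ?_, fun h1 h3 h6 ↦ ?_⟩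
  · -- fixed by `M`, moved by `A`
    exact card_fibre_eq_two_of_fixed₁₇ hc hfA hff (fixM.2 h1) (fun h ↦ ex13 h1 (fixA.1 h))
  · -- fixed by `A`, moved by `M`: swap the roles of `ν` and `π`
    refine card_fibre_eq_two_of_fixed₁₇ (ν := Quot.map aA cA) (π := Quot.map aM cM) (fun q ↦ (hc q).symm) hfM
      (fun q₁ q₂ h ↦ ?_) (fixA.2 h3) (fun h ↦ ex13 (fixM.1 h) h3)
    rcases hff q₁ q₂ h with h | h | h | h
    · exact Or.inl h
    · exact Or.inr (Or.inr (Or.inl h))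
    · exact Or.inr (Or.inl h)
    · exact Or.inr (Or.inr (Or.inr (by rw [hc]; exact h)))
  · -- fixed by `MA`, moved by `M`: the pair `ν = MA`, `π = M`
    refine card_fibre_eq_two_of_fixed₁₇ (ν := fun q ↦ Quot.map aM cM (Quot.map aA cA q)) (π := Quot.map aM cM)
      (fun q ↦ ?_) hfM (fun q₁ q₂ h ↦ ?_) (fixMA.2 h6) (fun h ↦ ex16 (fixM.1 h) h6)
    · show Quot.map aM cM (Quot.map aM cM (Quot.map aA cA q)) =
        Quot.map aM cM (Quot.map aA cA (Quot.map aM cM q))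
      rw [hMM, hc, hMM]
    · rcases hff q₁ q₂ h with h | h | h | h
      · exact Or.inl h
      · exact Or.inr (Or.inr (Or.inl h))
      · exact Or.inr (Or.inr (Or.inr (by rw [hc, hMM]; exact h)))
      · exact Or.inr (Or.inl h)
  · -- free
    exact card_fibre_eq_four_of_free₁₇ hMM hAA hc hfM hfA hff (fun h ↦ h1 (fixM.1 h)) (fun h ↦ h3 (fixA.1 h))
      (fun h ↦ h6 (fixMA.1 h))

/-- **THE FIBRE OF `X₆ → X₆⁺` THROUGH A `Z(1)`-POINT OF `Z(t)` HAS EXACTLY TWO CLASSES**: its stabiliser in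
`W ≅ (ℤ/2ℤ)²` is `⟨ω₂⟩` (not all of `W`: `Pt(1)`, `Pt(3)`, `Pt(6)` are pairwise disjoint). (E.g. `t = m²`: the two `Z(1)`-points `P₆, P₁₃₅` of `X₆` form one fibre over the order-`4` point of `X₆⁺`.)
[cite: Ogg1983RealPoints, §2 p. 284 («`ε = 1 + ζ₄`, if `m = 2`») and (4)] [cite: BayerTravesa2007, §2 and §7 Table 9] [cite: KudlaRapoportYang2006, §3.4 Prop. 3.4.1 and Remark 3.4.7] -/
theorem card_fibre_eq_two_of_mem_one {t : ℤ} (p : {τ : ℂ // 0 < τ.im ∧ ∃ x : ℍ[ℚ,((-1 : ℤ) : ℚ),((3 : ℤ) : ℚ)],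
        x ∈ order (-1) 3 ∧ x.re = 0 ∧ (x * star x).re = t ∧ moebius (rho (-1) 3 (by norm_num) (castQ (-1) 3 x)) τ = τ})
    (h : ∃ y : ℍ[ℚ,((-1 : ℤ) : ℚ),((3 : ℤ) : ℚ)], y ∈ order (-1) 3 ∧ y.re = 0 ∧ (y * star y).re = 1 ∧
        moebius (rho (-1) 3 (by norm_num) (castQ (-1) 3 y)) p.1 = p.1) :
    Nat.card {a : Quot (fun p q : {τ : ℂ // 0 < τ.im ∧ ∃ x : ℍ[ℚ,((-1 : ℤ) : ℚ),((3 : ℤ) : ℚ)],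
        x ∈ order (-1) 3 ∧ x.re = 0 ∧ (x * star x).re = t ∧ moebius (rho (-1) 3 (by norm_num) (castQ (-1) 3 x)) τ = τ} ↦
      ∃ v : ℍ[ℚ,((-1 : ℤ) : ℚ),((3 : ℤ) : ℚ)], (v ∈ order (-1) 3 ∨ v - ⟨1/2, 1/2, 1/2, -1/2⟩ ∈ order (-1) 3) ∧
        v * star v = 1 ∧ moebius (rho (-1) 3 (by norm_num) (castQ (-1) 3 v)) p.1 = q.1) //
      Quot.factor
      (fun p q : {τ : ℂ // 0 < τ.im ∧ ∃ x : ℍ[ℚ,((-1 : ℤ) : ℚ),((3 : ℤ) : ℚ)],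
        x ∈ order (-1) 3 ∧ x.re = 0 ∧ (x * star x).re = t ∧ moebius (rho (-1) 3 (by norm_num) (castQ (-1) 3 x)) τ = τ} ↦
        ∃ v : ℍ[ℚ,((-1 : ℤ) : ℚ),((3 : ℤ) : ℚ)], (v ∈ order (-1) 3 ∨ v - ⟨1/2, 1/2, 1/2, -1/2⟩ ∈ order (-1) 3) ∧
        v * star v = 1 ∧ moebius (rho (-1) 3 (by norm_num) (castQ (-1) 3 v)) p.1 = q.1)
      (fun p q : {τ : ℂ // 0 < τ.im ∧ ∃ x : ℍ[ℚ,((-1 : ℤ) : ℚ),((3 : ℤ) : ℚ)],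
        x ∈ order (-1) 3 ∧ x.re = 0 ∧ (x * star x).re = t ∧ moebius (rho (-1) 3 (by norm_num) (castQ (-1) 3 x)) τ = τ} ↦
        ∃ g : ℍ[ℚ,((-1 : ℤ) : ℚ),((3 : ℤ) : ℚ)], g ≠ 0 ∧
        (∀ a : ℍ[ℚ,((-1 : ℤ) : ℚ),((3 : ℤ) : ℚ)], (a ∈ order (-1) 3 ∨ a - ⟨1/2, 1/2, 1/2, -1/2⟩ ∈ order (-1) 3) →
          ∃ b : ℍ[ℚ,((-1 : ℤ) : ℚ),((3 : ℤ) : ℚ)], (b ∈ order (-1) 3 ∨ b - ⟨1/2, 1/2, 1/2, -1/2⟩ ∈ order (-1) 3) ∧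
            g * a = b * g) ∧
        0 < (g * star g).re ∧ moebius (rho (-1) 3 (by norm_num) (castQ (-1) 3 g)) p.1 = q.1)
      (specialPointsPlus_rel_of_specialPoints_rel t) a = Quot.mk _ p} = 2 :=
  (fibre_master₁₇ p).1 h

/-- **THE FIBRE OF `X₆ → X₆⁺` THROUGH A `Z(3)`-POINT OF `Z(t)` HAS EXACTLY TWO CLASSES**: its stabiliser in
`W ≅ (ℤ/2ℤ)²` is `⟨ω₃⟩` (not all of `W`: `Pt(1)`, `Pt(3)`, `Pt(6)` are pairwise disjoint). (E.g. `t = 3m²`: the two `Z(3)`-points `P₂, P₄` form one fibre over the order-`6` point of `X₆⁺`.)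
[cite: Ogg1983RealPoints, §2 p. 284 («`ε = 1 − ζ₃` if `m = 3`») and (4)] [cite: BayerTravesa2007, §2 and §7 Table 9] [cite: KudlaRapoportYang2006, §3.4 Prop. 3.4.1 and Remark 3.4.7] -/
theorem card_fibre_eq_two_of_mem_three {t : ℤ} (p : {τ : ℂ // 0 < τ.im ∧ ∃ x : ℍ[ℚ,((-1 : ℤ) : ℚ),((3 : ℤ) : ℚ)],
        x ∈ order (-1) 3 ∧ x.re = 0 ∧ (x * star x).re = t ∧ moebius (rho (-1) 3 (by norm_num) (castQ (-1) 3 x)) τ = τ})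
    (h : ∃ y : ℍ[ℚ,((-1 : ℤ) : ℚ),((3 : ℤ) : ℚ)], y ∈ order (-1) 3 ∧ y.re = 0 ∧ (y * star y).re = 3 ∧
        moebius (rho (-1) 3 (by norm_num) (castQ (-1) 3 y)) p.1 = p.1) :
    Nat.card {a : Quot (fun p q : {τ : ℂ // 0 < τ.im ∧ ∃ x : ℍ[ℚ,((-1 : ℤ) : ℚ),((3 : ℤ) : ℚ)],
        x ∈ order (-1) 3 ∧ x.re = 0 ∧ (x * star x).re = t ∧ moebius (rho (-1) 3 (by norm_num) (castQ (-1) 3 x)) τ = τ} ↦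
      ∃ v : ℍ[ℚ,((-1 : ℤ) : ℚ),((3 : ℤ) : ℚ)], (v ∈ order (-1) 3 ∨ v - ⟨1/2, 1/2, 1/2, -1/2⟩ ∈ order (-1) 3) ∧
        v * star v = 1 ∧ moebius (rho (-1) 3 (by norm_num) (castQ (-1) 3 v)) p.1 = q.1) //
      Quot.factor
      (fun p q : {τ : ℂ // 0 < τ.im ∧ ∃ x : ℍ[ℚ,((-1 : ℤ) : ℚ),((3 : ℤ) : ℚ)],
        x ∈ order (-1) 3 ∧ x.re = 0 ∧ (x * star x).re = t ∧ moebius (rho (-1) 3 (by norm_num) (castQ (-1) 3 x)) τ = τ} ↦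
        ∃ v : ℍ[ℚ,((-1 : ℤ) : ℚ),((3 : ℤ) : ℚ)], (v ∈ order (-1) 3 ∨ v - ⟨1/2, 1/2, 1/2, -1/2⟩ ∈ order (-1) 3) ∧
        v * star v = 1 ∧ moebius (rho (-1) 3 (by norm_num) (castQ (-1) 3 v)) p.1 = q.1)
      (fun p q : {τ : ℂ // 0 < τ.im ∧ ∃ x : ℍ[ℚ,((-1 : ℤ) : ℚ),((3 : ℤ) : ℚ)],
        x ∈ order (-1) 3 ∧ x.re = 0 ∧ (x * star x).re = t ∧ moebius (rho (-1) 3 (by norm_num) (castQ (-1) 3 x)) τ = τ} ↦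
        ∃ g : ℍ[ℚ,((-1 : ℤ) : ℚ),((3 : ℤ) : ℚ)], g ≠ 0 ∧
        (∀ a : ℍ[ℚ,((-1 : ℤ) : ℚ),((3 : ℤ) : ℚ)], (a ∈ order (-1) 3 ∨ a - ⟨1/2, 1/2, 1/2, -1/2⟩ ∈ order (-1) 3) →
          ∃ b : ℍ[ℚ,((-1 : ℤ) : ℚ),((3 : ℤ) : ℚ)], (b ∈ order (-1) 3 ∨ b - ⟨1/2, 1/2, 1/2, -1/2⟩ ∈ order (-1) 3) ∧
            g * a = b * g) ∧
        0 < (g * star g).re ∧ moebius (rho (-1) 3 (by norm_num) (castQ (-1) 3 g)) p.1 = q.1)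
      (specialPointsPlus_rel_of_specialPoints_rel t) a = Quot.mk _ p} = 2 :=
  (fibre_master₁₇ p).2.1 h

/-- **THE FIBRE OF `X₆ → X₆⁺` THROUGH A `Z(6)`-POINT OF `Z(t)` HAS EXACTLY TWO CLASSES**: its stabiliser in
`W ≅ (ℤ/2ℤ)²` is `⟨ω₆⟩` (not all of `W`: `Pt(1)`, `Pt(3)`, `Pt(6)` are pairwise disjoint). (E.g. `t = 6m²`: the two `Z(6)`-points `P₀, P₇` form one fibre over the order-`2` point of `X₆⁺`.)
[cite: Ogg1983RealPoints, §2 p. 284 («`μ² = −m`») and (4)] [cite: BayerTravesa2007, §2 and §7 Table 9] [cite: KudlaRapoportYang2006, §3.4 Prop. 3.4.1 and Remark 3.4.7] -/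
theorem card_fibre_eq_two_of_mem_six {t : ℤ} (p : {τ : ℂ // 0 < τ.im ∧ ∃ x : ℍ[ℚ,((-1 : ℤ) : ℚ),((3 : ℤ) : ℚ)],
        x ∈ order (-1) 3 ∧ x.re = 0 ∧ (x * star x).re = t ∧ moebius (rho (-1) 3 (by norm_num) (castQ (-1) 3 x)) τ = τ})
    (h : ∃ y : ℍ[ℚ,((-1 : ℤ) : ℚ),((3 : ℤ) : ℚ)], y ∈ order (-1) 3 ∧ y.re = 0 ∧ (y * star y).re = 6 ∧
        moebius (rho (-1) 3 (by norm_num) (castQ (-1) 3 y)) p.1 = p.1) :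
    Nat.card {a : Quot (fun p q : {τ : ℂ // 0 < τ.im ∧ ∃ x : ℍ[ℚ,((-1 : ℤ) : ℚ),((3 : ℤ) : ℚ)],
        x ∈ order (-1) 3 ∧ x.re = 0 ∧ (x * star x).re = t ∧ moebius (rho (-1) 3 (by norm_num) (castQ (-1) 3 x)) τ = τ} ↦
      ∃ v : ℍ[ℚ,((-1 : ℤ) : ℚ),((3 : ℤ) : ℚ)], (v ∈ order (-1) 3 ∨ v - ⟨1/2, 1/2, 1/2, -1/2⟩ ∈ order (-1) 3) ∧
        v * star v = 1 ∧ moebius (rho (-1) 3 (by norm_num) (castQ (-1) 3 v)) p.1 = q.1) //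
      Quot.factor
      (fun p q : {τ : ℂ // 0 < τ.im ∧ ∃ x : ℍ[ℚ,((-1 : ℤ) : ℚ),((3 : ℤ) : ℚ)],
        x ∈ order (-1) 3 ∧ x.re = 0 ∧ (x * star x).re = t ∧ moebius (rho (-1) 3 (by norm_num) (castQ (-1) 3 x)) τ = τ} ↦
        ∃ v : ℍ[ℚ,((-1 : ℤ) : ℚ),((3 : ℤ) : ℚ)], (v ∈ order (-1) 3 ∨ v - ⟨1/2, 1/2, 1/2, -1/2⟩ ∈ order (-1) 3) ∧
        v * star v = 1 ∧ moebius (rho (-1) 3 (by norm_num) (castQ (-1) 3 v)) p.1 = q.1)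
      (fun p q : {τ : ℂ // 0 < τ.im ∧ ∃ x : ℍ[ℚ,((-1 : ℤ) : ℚ),((3 : ℤ) : ℚ)],
        x ∈ order (-1) 3 ∧ x.re = 0 ∧ (x * star x).re = t ∧ moebius (rho (-1) 3 (by norm_num) (castQ (-1) 3 x)) τ = τ} ↦
        ∃ g : ℍ[ℚ,((-1 : ℤ) : ℚ),((3 : ℤ) : ℚ)], g ≠ 0 ∧
        (∀ a : ℍ[ℚ,((-1 : ℤ) : ℚ),((3 : ℤ) : ℚ)], (a ∈ order (-1) 3 ∨ a - ⟨1/2, 1/2, 1/2, -1/2⟩ ∈ order (-1) 3) →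
          ∃ b : ℍ[ℚ,((-1 : ℤ) : ℚ),((3 : ℤ) : ℚ)], (b ∈ order (-1) 3 ∨ b - ⟨1/2, 1/2, 1/2, -1/2⟩ ∈ order (-1) 3) ∧
            g * a = b * g) ∧
        0 < (g * star g).re ∧ moebius (rho (-1) 3 (by norm_num) (castQ (-1) 3 g)) p.1 = q.1)
      (specialPointsPlus_rel_of_specialPoints_rel t) a = Quot.mk _ p} = 2 :=
  (fibre_master₁₇ p).2.2.1 h

/-- **EVERY OTHER FIBRE HAS FOUR CLASSES**: off `Z(1) ∪ Z(3) ∪ Z(6)` the group `W ≅ (ℤ/2ℤ)²` acts freely on the points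
of `Z(t)` on `X₆`. [cite: KudlaRapoportYang2006, §3.4 Remark 3.4.7 («permutes the components transitively»)] [cite: Ogg1983RealPoints, §2 (2)–(4)] [cite: BayerTravesa2007, §2] [cite: VignerasLNM800, Ch. IV §3 B] -/
theorem card_fibre_eq_four_of_not_mem {t : ℤ} (p : {τ : ℂ // 0 < τ.im ∧ ∃ x : ℍ[ℚ,((-1 : ℤ) : ℚ),((3 : ℤ) : ℚ)],
        x ∈ order (-1) 3 ∧ x.re = 0 ∧ (x * star x).re = t ∧ moebius (rho (-1) 3 (by norm_num) (castQ (-1) 3 x)) τ = τ})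
    (h₁ : ¬ ∃ y : ℍ[ℚ,((-1 : ℤ) : ℚ),((3 : ℤ) : ℚ)], y ∈ order (-1) 3 ∧ y.re = 0 ∧ (y * star y).re = 1 ∧
        moebius (rho (-1) 3 (by norm_num) (castQ (-1) 3 y)) p.1 = p.1)
    (h₃ : ¬ ∃ y : ℍ[ℚ,((-1 : ℤ) : ℚ),((3 : ℤ) : ℚ)], y ∈ order (-1) 3 ∧ y.re = 0 ∧ (y * star y).re = 3 ∧
        moebius (rho (-1) 3 (by norm_num) (castQ (-1) 3 y)) p.1 = p.1)
    (h₆ : ¬ ∃ y : ℍ[ℚ,((-1 : ℤ) : ℚ),((3 : ℤ) : ℚ)], y ∈ order (-1) 3 ∧ y.re = 0 ∧ (y * star y).re = 6 ∧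
        moebius (rho (-1) 3 (by norm_num) (castQ (-1) 3 y)) p.1 = p.1) :
    Nat.card {a : Quot (fun p q : {τ : ℂ // 0 < τ.im ∧ ∃ x : ℍ[ℚ,((-1 : ℤ) : ℚ),((3 : ℤ) : ℚ)],
        x ∈ order (-1) 3 ∧ x.re = 0 ∧ (x * star x).re = t ∧ moebius (rho (-1) 3 (by norm_num) (castQ (-1) 3 x)) τ = τ} ↦
      ∃ v : ℍ[ℚ,((-1 : ℤ) : ℚ),((3 : ℤ) : ℚ)], (v ∈ order (-1) 3 ∨ v - ⟨1/2, 1/2, 1/2, -1/2⟩ ∈ order (-1) 3) ∧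
        v * star v = 1 ∧ moebius (rho (-1) 3 (by norm_num) (castQ (-1) 3 v)) p.1 = q.1) //
      Quot.factor
      (fun p q : {τ : ℂ // 0 < τ.im ∧ ∃ x : ℍ[ℚ,((-1 : ℤ) : ℚ),((3 : ℤ) : ℚ)],
        x ∈ order (-1) 3 ∧ x.re = 0 ∧ (x * star x).re = t ∧ moebius (rho (-1) 3 (by norm_num) (castQ (-1) 3 x)) τ = τ} ↦
        ∃ v : ℍ[ℚ,((-1 : ℤ) : ℚ),((3 : ℤ) : ℚ)], (v ∈ order (-1) 3 ∨ v - ⟨1/2, 1/2, 1/2, -1/2⟩ ∈ order (-1) 3) ∧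
        v * star v = 1 ∧ moebius (rho (-1) 3 (by norm_num) (castQ (-1) 3 v)) p.1 = q.1)
      (fun p q : {τ : ℂ // 0 < τ.im ∧ ∃ x : ℍ[ℚ,((-1 : ℤ) : ℚ),((3 : ℤ) : ℚ)],
        x ∈ order (-1) 3 ∧ x.re = 0 ∧ (x * star x).re = t ∧ moebius (rho (-1) 3 (by norm_num) (castQ (-1) 3 x)) τ = τ} ↦
        ∃ g : ℍ[ℚ,((-1 : ℤ) : ℚ),((3 : ℤ) : ℚ)], g ≠ 0 ∧
        (∀ a : ℍ[ℚ,((-1 : ℤ) : ℚ),((3 : ℤ) : ℚ)], (a ∈ order (-1) 3 ∨ a - ⟨1/2, 1/2, 1/2, -1/2⟩ ∈ order (-1) 3) →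
          ∃ b : ℍ[ℚ,((-1 : ℤ) : ℚ),((3 : ℤ) : ℚ)], (b ∈ order (-1) 3 ∨ b - ⟨1/2, 1/2, 1/2, -1/2⟩ ∈ order (-1) 3) ∧
            g * a = b * g) ∧
        0 < (g * star g).re ∧ moebius (rho (-1) 3 (by norm_num) (castQ (-1) 3 g)) p.1 = q.1)
      (specialPointsPlus_rel_of_specialPoints_rel t) a = Quot.mk _ p} = 4 :=
  (fibre_master₁₇ p).2.2.2 h₁ h₃ h₆

/-- **EVERY FIBRE OF `Pt(t)/Γ₆ → Pt(t)/Γ₆⁺` HAS `2` OR `4` CLASSES** (every `t`). [cite: KudlaRapoportYang2006, §3.4 Remark 3.4.7 and (3.4.13)] [cite: Ogg1983RealPoints, §2 (2)–(4)] [cite: BayerTravesa2007, §2] -/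
theorem card_fibre_eq_two_or_eq_four {t : ℤ} (c : Quot (fun p q : {τ : ℂ // 0 < τ.im ∧ ∃ x : ℍ[ℚ,((-1 : ℤ) : ℚ),((3 : ℤ) : ℚ)],
        x ∈ order (-1) 3 ∧ x.re = 0 ∧ (x * star x).re = t ∧ moebius (rho (-1) 3 (by norm_num) (castQ (-1) 3 x)) τ = τ} ↦
      ∃ g : ℍ[ℚ,((-1 : ℤ) : ℚ),((3 : ℤ) : ℚ)], g ≠ 0 ∧
        (∀ a : ℍ[ℚ,((-1 : ℤ) : ℚ),((3 : ℤ) : ℚ)], (a ∈ order (-1) 3 ∨ a - ⟨1/2, 1/2, 1/2, -1/2⟩ ∈ order (-1) 3) →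
          ∃ b : ℍ[ℚ,((-1 : ℤ) : ℚ),((3 : ℤ) : ℚ)], (b ∈ order (-1) 3 ∨ b - ⟨1/2, 1/2, 1/2, -1/2⟩ ∈ order (-1) 3) ∧
            g * a = b * g) ∧
        0 < (g * star g).re ∧ moebius (rho (-1) 3 (by norm_num) (castQ (-1) 3 g)) p.1 = q.1)) :
    Nat.card {a : Quot (fun p q : {τ : ℂ // 0 < τ.im ∧ ∃ x : ℍ[ℚ,((-1 : ℤ) : ℚ),((3 : ℤ) : ℚ)],
        x ∈ order (-1) 3 ∧ x.re = 0 ∧ (x * star x).re = t ∧ moebius (rho (-1) 3 (by norm_num) (castQ (-1) 3 x)) τ = τ} ↦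
      ∃ v : ℍ[ℚ,((-1 : ℤ) : ℚ),((3 : ℤ) : ℚ)], (v ∈ order (-1) 3 ∨ v - ⟨1/2, 1/2, 1/2, -1/2⟩ ∈ order (-1) 3) ∧
        v * star v = 1 ∧ moebius (rho (-1) 3 (by norm_num) (castQ (-1) 3 v)) p.1 = q.1) //
      Quot.factor
      (fun p q : {τ : ℂ // 0 < τ.im ∧ ∃ x : ℍ[ℚ,((-1 : ℤ) : ℚ),((3 : ℤ) : ℚ)],
        x ∈ order (-1) 3 ∧ x.re = 0 ∧ (x * star x).re = t ∧ moebius (rho (-1) 3 (by norm_num) (castQ (-1) 3 x)) τ = τ} ↦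
        ∃ v : ℍ[ℚ,((-1 : ℤ) : ℚ),((3 : ℤ) : ℚ)], (v ∈ order (-1) 3 ∨ v - ⟨1/2, 1/2, 1/2, -1/2⟩ ∈ order (-1) 3) ∧
        v * star v = 1 ∧ moebius (rho (-1) 3 (by norm_num) (castQ (-1) 3 v)) p.1 = q.1)
      (fun p q : {τ : ℂ // 0 < τ.im ∧ ∃ x : ℍ[ℚ,((-1 : ℤ) : ℚ),((3 : ℤ) : ℚ)],
        x ∈ order (-1) 3 ∧ x.re = 0 ∧ (x * star x).re = t ∧ moebius (rho (-1) 3 (by norm_num) (castQ (-1) 3 x)) τ = τ} ↦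
        ∃ g : ℍ[ℚ,((-1 : ℤ) : ℚ),((3 : ℤ) : ℚ)], g ≠ 0 ∧
        (∀ a : ℍ[ℚ,((-1 : ℤ) : ℚ),((3 : ℤ) : ℚ)], (a ∈ order (-1) 3 ∨ a - ⟨1/2, 1/2, 1/2, -1/2⟩ ∈ order (-1) 3) →
          ∃ b : ℍ[ℚ,((-1 : ℤ) : ℚ),((3 : ℤ) : ℚ)], (b ∈ order (-1) 3 ∨ b - ⟨1/2, 1/2, 1/2, -1/2⟩ ∈ order (-1) 3) ∧
            g * a = b * g) ∧
        0 < (g * star g).re ∧ moebius (rho (-1) 3 (by norm_num) (castQ (-1) 3 g)) p.1 = q.1)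
      (specialPointsPlus_rel_of_specialPoints_rel t) a = c} = 2 ∨
    Nat.card {a : Quot (fun p q : {τ : ℂ // 0 < τ.im ∧ ∃ x : ℍ[ℚ,((-1 : ℤ) : ℚ),((3 : ℤ) : ℚ)],
        x ∈ order (-1) 3 ∧ x.re = 0 ∧ (x * star x).re = t ∧ moebius (rho (-1) 3 (by norm_num) (castQ (-1) 3 x)) τ = τ} ↦
      ∃ v : ℍ[ℚ,((-1 : ℤ) : ℚ),((3 : ℤ) : ℚ)], (v ∈ order (-1) 3 ∨ v - ⟨1/2, 1/2, 1/2, -1/2⟩ ∈ order (-1) 3) ∧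
        v * star v = 1 ∧ moebius (rho (-1) 3 (by norm_num) (castQ (-1) 3 v)) p.1 = q.1) //
      Quot.factor
      (fun p q : {τ : ℂ // 0 < τ.im ∧ ∃ x : ℍ[ℚ,((-1 : ℤ) : ℚ),((3 : ℤ) : ℚ)],
        x ∈ order (-1) 3 ∧ x.re = 0 ∧ (x * star x).re = t ∧ moebius (rho (-1) 3 (by norm_num) (castQ (-1) 3 x)) τ = τ} ↦
        ∃ v : ℍ[ℚ,((-1 : ℤ) : ℚ),((3 : ℤ) : ℚ)], (v ∈ order (-1) 3 ∨ v - ⟨1/2, 1/2, 1/2, -1/2⟩ ∈ order (-1) 3) ∧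
        v * star v = 1 ∧ moebius (rho (-1) 3 (by norm_num) (castQ (-1) 3 v)) p.1 = q.1)
      (fun p q : {τ : ℂ // 0 < τ.im ∧ ∃ x : ℍ[ℚ,((-1 : ℤ) : ℚ),((3 : ℤ) : ℚ)],
        x ∈ order (-1) 3 ∧ x.re = 0 ∧ (x * star x).re = t ∧ moebius (rho (-1) 3 (by norm_num) (castQ (-1) 3 x)) τ = τ} ↦
        ∃ g : ℍ[ℚ,((-1 : ℤ) : ℚ),((3 : ℤ) : ℚ)], g ≠ 0 ∧
        (∀ a : ℍ[ℚ,((-1 : ℤ) : ℚ),((3 : ℤ) : ℚ)], (a ∈ order (-1) 3 ∨ a - ⟨1/2, 1/2, 1/2, -1/2⟩ ∈ order (-1) 3) →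
          ∃ b : ℍ[ℚ,((-1 : ℤ) : ℚ),((3 : ℤ) : ℚ)], (b ∈ order (-1) 3 ∨ b - ⟨1/2, 1/2, 1/2, -1/2⟩ ∈ order (-1) 3) ∧
            g * a = b * g) ∧
        0 < (g * star g).re ∧ moebius (rho (-1) 3 (by norm_num) (castQ (-1) 3 g)) p.1 = q.1)
      (specialPointsPlus_rel_of_specialPoints_rel t) a = c} = 4 := by
  induction c using Quot.ind with
  | _ p =>
    by_cases h₁ : ∃ y : ℍ[ℚ,((-1 : ℤ) : ℚ),((3 : ℤ) : ℚ)], y ∈ order (-1) 3 ∧ y.re = 0 ∧ (y * star y).re = 1 ∧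
        moebius (rho (-1) 3 (by norm_num) (castQ (-1) 3 y)) p.1 = p.1
    · exact Or.inl (card_fibre_eq_two_of_mem_one p h₁)
    by_cases h₃ : ∃ y : ℍ[ℚ,((-1 : ℤ) : ℚ),((3 : ℤ) : ℚ)], y ∈ order (-1) 3 ∧ y.re = 0 ∧ (y * star y).re = 3 ∧
        moebius (rho (-1) 3 (by norm_num) (castQ (-1) 3 y)) p.1 = p.1
    · exact Or.inl (card_fibre_eq_two_of_mem_three p h₃)
    by_cases h₆ : ∃ y : ℍ[ℚ,((-1 : ℤ) : ℚ),((3 : ℤ) : ℚ)], y ∈ order (-1) 3 ∧ y.re = 0 ∧ (y * star y).re = 6 ∧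
        moebius (rho (-1) 3 (by norm_num) (castQ (-1) 3 y)) p.1 = p.1
    · exact Or.inl (card_fibre_eq_two_of_mem_six p h₆)
    exact Or.inr (card_fibre_eq_four_of_not_mem p h₁ h₃ h₆)

/-- **A FIBRE HAS TWO CLASSES IFF IT IS THE FIBRE OF A `Z(1)`-, `Z(3)`- OR `Z(6)`-POINT.** [cite: Ogg1983RealPoints, §2 p. 284 and (4)] [cite: BayerTravesa2007, §1 Thm. 1.1, §2 and §7 Table 9] [cite: KudlaRapoportYang2006, §3.4 Remark 3.4.7] -/
theorem card_fibre_eq_two_iff {t : ℤ} (p : {τ : ℂ // 0 < τ.im ∧ ∃ x : ℍ[ℚ,((-1 : ℤ) : ℚ),((3 : ℤ) : ℚ)],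
        x ∈ order (-1) 3 ∧ x.re = 0 ∧ (x * star x).re = t ∧ moebius (rho (-1) 3 (by norm_num) (castQ (-1) 3 x)) τ = τ}) :
    Nat.card {a : Quot (fun p q : {τ : ℂ // 0 < τ.im ∧ ∃ x : ℍ[ℚ,((-1 : ℤ) : ℚ),((3 : ℤ) : ℚ)],
        x ∈ order (-1) 3 ∧ x.re = 0 ∧ (x * star x).re = t ∧ moebius (rho (-1) 3 (by norm_num) (castQ (-1) 3 x)) τ = τ} ↦
      ∃ v : ℍ[ℚ,((-1 : ℤ) : ℚ),((3 : ℤ) : ℚ)], (v ∈ order (-1) 3 ∨ v - ⟨1/2, 1/2, 1/2, -1/2⟩ ∈ order (-1) 3) ∧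
        v * star v = 1 ∧ moebius (rho (-1) 3 (by norm_num) (castQ (-1) 3 v)) p.1 = q.1) //
      Quot.factor
      (fun p q : {τ : ℂ // 0 < τ.im ∧ ∃ x : ℍ[ℚ,((-1 : ℤ) : ℚ),((3 : ℤ) : ℚ)],
        x ∈ order (-1) 3 ∧ x.re = 0 ∧ (x * star x).re = t ∧ moebius (rho (-1) 3 (by norm_num) (castQ (-1) 3 x)) τ = τ} ↦
        ∃ v : ℍ[ℚ,((-1 : ℤ) : ℚ),((3 : ℤ) : ℚ)], (v ∈ order (-1) 3 ∨ v - ⟨1/2, 1/2, 1/2, -1/2⟩ ∈ order (-1) 3) ∧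
        v * star v = 1 ∧ moebius (rho (-1) 3 (by norm_num) (castQ (-1) 3 v)) p.1 = q.1)
      (fun p q : {τ : ℂ // 0 < τ.im ∧ ∃ x : ℍ[ℚ,((-1 : ℤ) : ℚ),((3 : ℤ) : ℚ)],
        x ∈ order (-1) 3 ∧ x.re = 0 ∧ (x * star x).re = t ∧ moebius (rho (-1) 3 (by norm_num) (castQ (-1) 3 x)) τ = τ} ↦
        ∃ g : ℍ[ℚ,((-1 : ℤ) : ℚ),((3 : ℤ) : ℚ)], g ≠ 0 ∧
        (∀ a : ℍ[ℚ,((-1 : ℤ) : ℚ),((3 : ℤ) : ℚ)], (a ∈ order (-1) 3 ∨ a - ⟨1/2, 1/2, 1/2, -1/2⟩ ∈ order (-1) 3) →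
          ∃ b : ℍ[ℚ,((-1 : ℤ) : ℚ),((3 : ℤ) : ℚ)], (b ∈ order (-1) 3 ∨ b - ⟨1/2, 1/2, 1/2, -1/2⟩ ∈ order (-1) 3) ∧
            g * a = b * g) ∧
        0 < (g * star g).re ∧ moebius (rho (-1) 3 (by norm_num) (castQ (-1) 3 g)) p.1 = q.1)
      (specialPointsPlus_rel_of_specialPoints_rel t) a = Quot.mk _ p} = 2 ↔
    (∃ y : ℍ[ℚ,((-1 : ℤ) : ℚ),((3 : ℤ) : ℚ)], y ∈ order (-1) 3 ∧ y.re = 0 ∧ (y * star y).re = 1 ∧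
        moebius (rho (-1) 3 (by norm_num) (castQ (-1) 3 y)) p.1 = p.1) ∨
    (∃ y : ℍ[ℚ,((-1 : ℤ) : ℚ),((3 : ℤ) : ℚ)], y ∈ order (-1) 3 ∧ y.re = 0 ∧ (y * star y).re = 3 ∧
        moebius (rho (-1) 3 (by norm_num) (castQ (-1) 3 y)) p.1 = p.1) ∨
    (∃ y : ℍ[ℚ,((-1 : ℤ) : ℚ),((3 : ℤ) : ℚ)], y ∈ order (-1) 3 ∧ y.re = 0 ∧ (y * star y).re = 6 ∧
        moebius (rho (-1) 3 (by norm_num) (castQ (-1) 3 y)) p.1 = p.1) := by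
  constructor
  · intro h
    by_contra hne
    have h₁ : ¬ ∃ y : ℍ[ℚ,((-1 : ℤ) : ℚ),((3 : ℤ) : ℚ)], y ∈ order (-1) 3 ∧ y.re = 0 ∧ (y * star y).re = 1 ∧
        moebius (rho (-1) 3 (by norm_num) (castQ (-1) 3 y)) p.1 = p.1 := fun h' ↦ hne (Or.inl h')
    have h₃ : ¬ ∃ y : ℍ[ℚ,((-1 : ℤ) : ℚ),((3 : ℤ) : ℚ)], y ∈ order (-1) 3 ∧ y.re = 0 ∧ (y * star y).re = 3 ∧
        moebius (rho (-1) 3 (by norm_num) (castQ (-1) 3 y)) p.1 = p.1 := fun h' ↦ hne (Or.inr (Or.inl h'))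
    have h₆ : ¬ ∃ y : ℍ[ℚ,((-1 : ℤ) : ℚ),((3 : ℤ) : ℚ)], y ∈ order (-1) 3 ∧ y.re = 0 ∧ (y * star y).re = 6 ∧
        moebius (rho (-1) 3 (by norm_num) (castQ (-1) 3 y)) p.1 = p.1 := fun h' ↦ hne (Or.inr (Or.inr h'))
    have h4 := card_fibre_eq_four_of_not_mem p h₁ h₃ h₆
    omega
  · rintro (h | h | h)
    · exact card_fibre_eq_two_of_mem_one p h
    · exact card_fibre_eq_two_of_mem_three p h
    · exact card_fibre_eq_two_of_mem_six p h

/-- **A FIBRE HAS FOUR CLASSES IFF IT AVOIDS `Z(1) ∪ Z(3) ∪ Z(6)`.** [cite: KudlaRapoportYang2006, §3.4 Remark 3.4.7] [cite: Ogg1983RealPoints, §2 (2)–(4)] [cite: BayerTravesa2007, §2] -/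
theorem card_fibre_eq_four_iff {t : ℤ} (p : {τ : ℂ // 0 < τ.im ∧ ∃ x : ℍ[ℚ,((-1 : ℤ) : ℚ),((3 : ℤ) : ℚ)],
        x ∈ order (-1) 3 ∧ x.re = 0 ∧ (x * star x).re = t ∧ moebius (rho (-1) 3 (by norm_num) (castQ (-1) 3 x)) τ = τ}) :
    Nat.card {a : Quot (fun p q : {τ : ℂ // 0 < τ.im ∧ ∃ x : ℍ[ℚ,((-1 : ℤ) : ℚ),((3 : ℤ) : ℚ)],
        x ∈ order (-1) 3 ∧ x.re = 0 ∧ (x * star x).re = t ∧ moebius (rho (-1) 3 (by norm_num) (castQ (-1) 3 x)) τ = τ} ↦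
      ∃ v : ℍ[ℚ,((-1 : ℤ) : ℚ),((3 : ℤ) : ℚ)], (v ∈ order (-1) 3 ∨ v - ⟨1/2, 1/2, 1/2, -1/2⟩ ∈ order (-1) 3) ∧
        v * star v = 1 ∧ moebius (rho (-1) 3 (by norm_num) (castQ (-1) 3 v)) p.1 = q.1) //
      Quot.factor
      (fun p q : {τ : ℂ // 0 < τ.im ∧ ∃ x : ℍ[ℚ,((-1 : ℤ) : ℚ),((3 : ℤ) : ℚ)],
        x ∈ order (-1) 3 ∧ x.re = 0 ∧ (x * star x).re = t ∧ moebius (rho (-1) 3 (by norm_num) (castQ (-1) 3 x)) τ = τ} ↦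
        ∃ v : ℍ[ℚ,((-1 : ℤ) : ℚ),((3 : ℤ) : ℚ)], (v ∈ order (-1) 3 ∨ v - ⟨1/2, 1/2, 1/2, -1/2⟩ ∈ order (-1) 3) ∧
        v * star v = 1 ∧ moebius (rho (-1) 3 (by norm_num) (castQ (-1) 3 v)) p.1 = q.1)
      (fun p q : {τ : ℂ // 0 < τ.im ∧ ∃ x : ℍ[ℚ,((-1 : ℤ) : ℚ),((3 : ℤ) : ℚ)],
        x ∈ order (-1) 3 ∧ x.re = 0 ∧ (x * star x).re = t ∧ moebius (rho (-1) 3 (by norm_num) (castQ (-1) 3 x)) τ = τ} ↦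
        ∃ g : ℍ[ℚ,((-1 : ℤ) : ℚ),((3 : ℤ) : ℚ)], g ≠ 0 ∧
        (∀ a : ℍ[ℚ,((-1 : ℤ) : ℚ),((3 : ℤ) : ℚ)], (a ∈ order (-1) 3 ∨ a - ⟨1/2, 1/2, 1/2, -1/2⟩ ∈ order (-1) 3) →
          ∃ b : ℍ[ℚ,((-1 : ℤ) : ℚ),((3 : ℤ) : ℚ)], (b ∈ order (-1) 3 ∨ b - ⟨1/2, 1/2, 1/2, -1/2⟩ ∈ order (-1) 3) ∧
            g * a = b * g) ∧
        0 < (g * star g).re ∧ moebius (rho (-1) 3 (by norm_num) (castQ (-1) 3 g)) p.1 = q.1)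
      (specialPointsPlus_rel_of_specialPoints_rel t) a = Quot.mk _ p} = 4 ↔
    ¬ ((∃ y : ℍ[ℚ,((-1 : ℤ) : ℚ),((3 : ℤ) : ℚ)], y ∈ order (-1) 3 ∧ y.re = 0 ∧ (y * star y).re = 1 ∧
        moebius (rho (-1) 3 (by norm_num) (castQ (-1) 3 y)) p.1 = p.1) ∨
    (∃ y : ℍ[ℚ,((-1 : ℤ) : ℚ),((3 : ℤ) : ℚ)], y ∈ order (-1) 3 ∧ y.re = 0 ∧ (y * star y).re = 3 ∧
        moebius (rho (-1) 3 (by norm_num) (castQ (-1) 3 y)) p.1 = p.1) ∨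
    (∃ y : ℍ[ℚ,((-1 : ℤ) : ℚ),((3 : ℤ) : ℚ)], y ∈ order (-1) 3 ∧ y.re = 0 ∧ (y * star y).re = 6 ∧
        moebius (rho (-1) 3 (by norm_num) (castQ (-1) 3 y)) p.1 = p.1)) := by
  rw [← card_fibre_eq_two_iff p]
  have h := card_fibre_eq_two_or_eq_four (t := t) (Quot.mk _ p)
  constructor
  · intro h4; omega
  · intro h2; omega

end Fibres

/-! ## §3 At most one two-class fibre (`t > 0`), present iff `t ∈ ℤ² ∪ 3ℤ² ∪ 6ℤ²` -/

section TwoFibres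

/-- **ANY TWO TWO-CLASS FIBRES COINCIDE** (`t > 0`): both are fibres of `Z(t₀)`-points with the SAME `t₀ ∈ {1, 3, 6}`
(`t = m²t₀` and `ℤ²`, `3ℤ²`, `6ℤ²` are pairwise disjoint off `0`), and `Z(t₀)` has a single point on `X₆⁺`
(`#(Pt(t₀)/Γ₆⁺) = 1`: the vertex `P₆`, `P₄` resp. `P₀` of `t₆⁺`). [cite: BayerTravesa2007, §7 Table 9 and §2] [cite: Ogg1983RealPoints, §2 (4)] [cite: KudlaRapoportYang2006, §3.4 (3.4.6) and Prop. 3.4.1] -/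
theorem subsingleton_twoFibres {t : ℤ} (ht : 0 < t) :
    Subsingleton {c : Quot (fun p q : {τ : ℂ // 0 < τ.im ∧ ∃ x : ℍ[ℚ,((-1 : ℤ) : ℚ),((3 : ℤ) : ℚ)],
        x ∈ order (-1) 3 ∧ x.re = 0 ∧ (x * star x).re = t ∧ moebius (rho (-1) 3 (by norm_num) (castQ (-1) 3 x)) τ = τ} ↦
      ∃ g : ℍ[ℚ,((-1 : ℤ) : ℚ),((3 : ℤ) : ℚ)], g ≠ 0 ∧
        (∀ a : ℍ[ℚ,((-1 : ℤ) : ℚ),((3 : ℤ) : ℚ)], (a ∈ order (-1) 3 ∨ a - ⟨1/2, 1/2, 1/2, -1/2⟩ ∈ order (-1) 3) →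
          ∃ b : ℍ[ℚ,((-1 : ℤ) : ℚ),((3 : ℤ) : ℚ)], (b ∈ order (-1) 3 ∨ b - ⟨1/2, 1/2, 1/2, -1/2⟩ ∈ order (-1) 3) ∧
            g * a = b * g) ∧
        0 < (g * star g).re ∧ moebius (rho (-1) 3 (by norm_num) (castQ (-1) 3 g)) p.1 = q.1) //
      Nat.card {a : Quot (fun p q : {τ : ℂ // 0 < τ.im ∧ ∃ x : ℍ[ℚ,((-1 : ℤ) : ℚ),((3 : ℤ) : ℚ)],
        x ∈ order (-1) 3 ∧ x.re = 0 ∧ (x * star x).re = t ∧ moebius (rho (-1) 3 (by norm_num) (castQ (-1) 3 x)) τ = τ} ↦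
      ∃ v : ℍ[ℚ,((-1 : ℤ) : ℚ),((3 : ℤ) : ℚ)], (v ∈ order (-1) 3 ∨ v - ⟨1/2, 1/2, 1/2, -1/2⟩ ∈ order (-1) 3) ∧
        v * star v = 1 ∧ moebius (rho (-1) 3 (by norm_num) (castQ (-1) 3 v)) p.1 = q.1) //
      Quot.factor
      (fun p q : {τ : ℂ // 0 < τ.im ∧ ∃ x : ℍ[ℚ,((-1 : ℤ) : ℚ),((3 : ℤ) : ℚ)],
        x ∈ order (-1) 3 ∧ x.re = 0 ∧ (x * star x).re = t ∧ moebius (rho (-1) 3 (by norm_num) (castQ (-1) 3 x)) τ = τ} ↦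
        ∃ v : ℍ[ℚ,((-1 : ℤ) : ℚ),((3 : ℤ) : ℚ)], (v ∈ order (-1) 3 ∨ v - ⟨1/2, 1/2, 1/2, -1/2⟩ ∈ order (-1) 3) ∧
        v * star v = 1 ∧ moebius (rho (-1) 3 (by norm_num) (castQ (-1) 3 v)) p.1 = q.1)
      (fun p q : {τ : ℂ // 0 < τ.im ∧ ∃ x : ℍ[ℚ,((-1 : ℤ) : ℚ),((3 : ℤ) : ℚ)],
        x ∈ order (-1) 3 ∧ x.re = 0 ∧ (x * star x).re = t ∧ moebius (rho (-1) 3 (by norm_num) (castQ (-1) 3 x)) τ = τ} ↦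
        ∃ g : ℍ[ℚ,((-1 : ℤ) : ℚ),((3 : ℤ) : ℚ)], g ≠ 0 ∧
        (∀ a : ℍ[ℚ,((-1 : ℤ) : ℚ),((3 : ℤ) : ℚ)], (a ∈ order (-1) 3 ∨ a - ⟨1/2, 1/2, 1/2, -1/2⟩ ∈ order (-1) 3) →
          ∃ b : ℍ[ℚ,((-1 : ℤ) : ℚ),((3 : ℤ) : ℚ)], (b ∈ order (-1) 3 ∨ b - ⟨1/2, 1/2, 1/2, -1/2⟩ ∈ order (-1) 3) ∧
            g * a = b * g) ∧
        0 < (g * star g).re ∧ moebius (rho (-1) 3 (by norm_num) (castQ (-1) 3 g)) p.1 = q.1)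
      (specialPointsPlus_rel_of_specialPoints_rel t) a = c} = 2} := by
  set S : {τ : ℂ // 0 < τ.im ∧ ∃ x : ℍ[ℚ,((-1 : ℤ) : ℚ),((3 : ℤ) : ℚ)],
        x ∈ order (-1) 3 ∧ x.re = 0 ∧ (x * star x).re = t ∧ moebius (rho (-1) 3 (by norm_num) (castQ (-1) 3 x)) τ = τ} →
      {τ : ℂ // 0 < τ.im ∧ ∃ x : ℍ[ℚ,((-1 : ℤ) : ℚ),((3 : ℤ) : ℚ)],
        x ∈ order (-1) 3 ∧ x.re = 0 ∧ (x * star x).re = t ∧ moebius (rho (-1) 3 (by norm_num) (castQ (-1) 3 x)) τ = τ} → Prop :=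
    fun p q ↦ ∃ v : ℍ[ℚ,((-1 : ℤ) : ℚ),((3 : ℤ) : ℚ)], (v ∈ order (-1) 3 ∨ v - ⟨1/2, 1/2, 1/2, -1/2⟩ ∈ order (-1) 3) ∧
        v * star v = 1 ∧ moebius (rho (-1) 3 (by norm_num) (castQ (-1) 3 v)) p.1 = q.1 with hS
  set P : {τ : ℂ // 0 < τ.im ∧ ∃ x : ℍ[ℚ,((-1 : ℤ) : ℚ),((3 : ℤ) : ℚ)],
        x ∈ order (-1) 3 ∧ x.re = 0 ∧ (x * star x).re = t ∧ moebius (rho (-1) 3 (by norm_num) (castQ (-1) 3 x)) τ = τ} →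
      {τ : ℂ // 0 < τ.im ∧ ∃ x : ℍ[ℚ,((-1 : ℤ) : ℚ),((3 : ℤ) : ℚ)],
        x ∈ order (-1) 3 ∧ x.re = 0 ∧ (x * star x).re = t ∧ moebius (rho (-1) 3 (by norm_num) (castQ (-1) 3 x)) τ = τ} → Prop :=
    fun p q ↦ ∃ g : ℍ[ℚ,((-1 : ℤ) : ℚ),((3 : ℤ) : ℚ)], g ≠ 0 ∧
        (∀ a : ℍ[ℚ,((-1 : ℤ) : ℚ),((3 : ℤ) : ℚ)], (a ∈ order (-1) 3 ∨ a - ⟨1/2, 1/2, 1/2, -1/2⟩ ∈ order (-1) 3) →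
          ∃ b : ℍ[ℚ,((-1 : ℤ) : ℚ),((3 : ℤ) : ℚ)], (b ∈ order (-1) 3 ∨ b - ⟨1/2, 1/2, 1/2, -1/2⟩ ∈ order (-1) 3) ∧
            g * a = b * g) ∧
        0 < (g * star g).re ∧ moebius (rho (-1) 3 (by norm_num) (castQ (-1) 3 g)) p.1 = q.1 with hP
  have hiffP : ∀ p q, Quot.mk P p = Quot.mk P q ↔ P p q := specialPointsPlus_mk_eq_iff t
  -- one `Γ₆⁺`-class of points on `Pt(1)`, `Pt(3)`, `Pt(6)`
  have one₁ := (Nat.card_eq_one_iff_unique.1 card_specialPointsPlus_one).1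
  have one₃ := (Nat.card_eq_one_iff_unique.1 card_specialPointsPlus_three).1
  have one₆ := (Nat.card_eq_one_iff_unique.1 card_specialPointsPlus_six).1
  -- the shape of `t` at a two-class fibre
  have shape : ∀ p : {τ : ℂ // 0 < τ.im ∧ ∃ x : ℍ[ℚ,((-1 : ℤ) : ℚ),((3 : ℤ) : ℚ)],
        x ∈ order (-1) 3 ∧ x.re = 0 ∧ (x * star x).re = t ∧ moebius (rho (-1) 3 (by norm_num) (castQ (-1) 3 x)) τ = τ},
      Nat.card {a : Quot S // Quot.factor S P (specialPointsPlus_rel_of_specialPoints_rel t) a = Quot.mk P p} = 2 →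
      ((∃ y : ℍ[ℚ,((-1 : ℤ) : ℚ),((3 : ℤ) : ℚ)], y ∈ order (-1) 3 ∧ y.re = 0 ∧ (y * star y).re = 1 ∧
        moebius (rho (-1) 3 (by norm_num) (castQ (-1) 3 y)) p.1 = p.1) ∧ ∃ m : ℤ, t = m ^ 2) ∨
      ((∃ y : ℍ[ℚ,((-1 : ℤ) : ℚ),((3 : ℤ) : ℚ)], y ∈ order (-1) 3 ∧ y.re = 0 ∧ (y * star y).re = 3 ∧
        moebius (rho (-1) 3 (by norm_num) (castQ (-1) 3 y)) p.1 = p.1) ∧ ∃ m : ℤ, t = 3 * m ^ 2) ∨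
      ((∃ y : ℍ[ℚ,((-1 : ℤ) : ℚ),((3 : ℤ) : ℚ)], y ∈ order (-1) 3 ∧ y.re = 0 ∧ (y * star y).re = 6 ∧
        moebius (rho (-1) 3 (by norm_num) (castQ (-1) 3 y)) p.1 = p.1) ∧ ∃ m : ℤ, t = 6 * m ^ 2) := by
    intro p h2
    obtain ⟨x, -, hxre, hxn, hfx⟩ := p.2.2
    rcases (card_fibre_eq_two_iff p).1 h2 with h | h | h
    · obtain ⟨y, -, hyre, hyn, hfy⟩ := id h
      exact Or.inl ⟨h, exists_eq_sq_of_specialPoints_inter_one p.2.1.ne' hxre hyre hxn hyn hfx hfy⟩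
    · obtain ⟨y, -, hyre, hyn, hfy⟩ := id h
      exact Or.inr (Or.inl ⟨h, exists_eq_three_mul_sq_of_specialPoints_inter_three p.2.1.ne' hxre hyre hxn hyn hfx hfy⟩)
    · obtain ⟨y, -, hyre, hyn, hfy⟩ := id h
      exact Or.inr (Or.inr ⟨h, exists_eq_six_mul_sq_of_specialPoints_inter_six p.2.1.ne' hxre hyre hxn hyn hfx hfy⟩)
  -- two points of `Pt(t)` lying on the same `Pt(t₀)`, `t₀ = 1, 3, 6`, are `Γ₆⁺`-equivalent
  have key : ∀ (t₀ : ℤ), Subsingleton (Quot (fun p q : {τ : ℂ // 0 < τ.im ∧ ∃ x : ℍ[ℚ,((-1 : ℤ) : ℚ),((3 : ℤ) : ℚ)],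
        x ∈ order (-1) 3 ∧ x.re = 0 ∧ (x * star x).re = t₀ ∧ moebius (rho (-1) 3 (by norm_num) (castQ (-1) 3 x)) τ = τ} ↦
            ∃ g : ℍ[ℚ,((-1 : ℤ) : ℚ),((3 : ℤ) : ℚ)], g ≠ 0 ∧
        (∀ a : ℍ[ℚ,((-1 : ℤ) : ℚ),((3 : ℤ) : ℚ)], (a ∈ order (-1) 3 ∨ a - ⟨1/2, 1/2, 1/2, -1/2⟩ ∈ order (-1) 3) →
          ∃ b : ℍ[ℚ,((-1 : ℤ) : ℚ),((3 : ℤ) : ℚ)], (b ∈ order (-1) 3 ∨ b - ⟨1/2, 1/2, 1/2, -1/2⟩ ∈ order (-1) 3) ∧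
            g * a = b * g) ∧
        0 < (g * star g).re ∧ moebius (rho (-1) 3 (by norm_num) (castQ (-1) 3 g)) p.1 = q.1)) →
      ∀ p q : {τ : ℂ // 0 < τ.im ∧ ∃ x : ℍ[ℚ,((-1 : ℤ) : ℚ),((3 : ℤ) : ℚ)],
        x ∈ order (-1) 3 ∧ x.re = 0 ∧ (x * star x).re = t ∧ moebius (rho (-1) 3 (by norm_num) (castQ (-1) 3 x)) τ = τ},
      (∃ y : ℍ[ℚ,((-1 : ℤ) : ℚ),((3 : ℤ) : ℚ)], y ∈ order (-1) 3 ∧ y.re = 0 ∧ (y * star y).re = t₀ ∧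
        moebius (rho (-1) 3 (by norm_num) (castQ (-1) 3 y)) p.1 = p.1) →
      (∃ y : ℍ[ℚ,((-1 : ℤ) : ℚ),((3 : ℤ) : ℚ)], y ∈ order (-1) 3 ∧ y.re = 0 ∧ (y * star y).re = t₀ ∧
        moebius (rho (-1) 3 (by norm_num) (castQ (-1) 3 y)) q.1 = q.1) →
      Quot.mk P p = Quot.mk P q := by
    intro t₀ hsub p q hp hq
    have e := hsub.elim (Quot.mk _ ⟨p.1, p.2.1, hp⟩) (Quot.mk _ ⟨q.1, q.2.1, hq⟩)
    rw [specialPointsPlus_mk_eq_iff t₀] at e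
    rw [hiffP]
    exact e
  refine ⟨fun c₁ c₂ ↦ Subtype.ext ?_⟩
  obtain ⟨c₁, hc₁⟩ := c₁
  obtain ⟨c₂, hc₂⟩ := c₂
  induction c₁ using Quot.ind with
  | _ p₁ =>
    induction c₂ using Quot.ind with
    | _ p₂ =>
      change Quot.mk P p₁ = Quot.mk P p₂
      have ht0 : t ≠ 0 := ht.ne'
      rcases shape p₁ hc₁ with ⟨m₁, s₁⟩ | ⟨m₁, s₁⟩ | ⟨m₁, s₁⟩ <;>
        rcases shape p₂ hc₂ with ⟨m₂, s₂⟩ | ⟨m₂, s₂⟩ | ⟨m₂, s₂⟩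
      · exact key 1 one₁ p₁ p₂ (by push_cast; exact m₁) (by push_cast; exact m₂)
      · obtain ⟨m, hm⟩ := s₁
        exact absurd s₂ (not_three_mul_sq_of_sq₁₇ ht0 hm)
      · obtain ⟨m, hm⟩ := s₁
        exact absurd s₂ (not_six_mul_sq_of_sq₁₇ ht0 hm)
      · obtain ⟨m, hm⟩ := s₂
        exact absurd s₁ (not_three_mul_sq_of_sq₁₇ ht0 hm)
      · exact key 3 one₃ p₁ p₂ (by push_cast; exact m₁) (by push_cast; exact m₂)
      · obtain ⟨m, hm⟩ := s₁
        exact absurd s₂ (not_six_mul_sq_of_three_mul_sq₁₇ ht0 hm)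
      · obtain ⟨m, hm⟩ := s₂
        exact absurd s₁ (not_six_mul_sq_of_sq₁₇ ht0 hm)
      · obtain ⟨m, hm⟩ := s₂
        exact absurd s₁ (not_six_mul_sq_of_three_mul_sq₁₇ ht0 hm)
      · exact key 6 one₆ p₁ p₂ (by push_cast; exact m₁) (by push_cast; exact m₂)

/-- **AT MOST ONE TWO-CLASS FIBRE** (`t > 0`). [cite: BayerTravesa2007, §7 Table 9 and §2] [cite: Ogg1983RealPoints, §2 (4)] [cite: KudlaRapoportYang2006, §3.4 (3.4.6)] -/
theorem card_twoFibres_le_one {t : ℤ} (ht : 0 < t) :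
    Nat.card {c : Quot (fun p q : {τ : ℂ // 0 < τ.im ∧ ∃ x : ℍ[ℚ,((-1 : ℤ) : ℚ),((3 : ℤ) : ℚ)],
        x ∈ order (-1) 3 ∧ x.re = 0 ∧ (x * star x).re = t ∧ moebius (rho (-1) 3 (by norm_num) (castQ (-1) 3 x)) τ = τ} ↦
      ∃ g : ℍ[ℚ,((-1 : ℤ) : ℚ),((3 : ℤ) : ℚ)], g ≠ 0 ∧
        (∀ a : ℍ[ℚ,((-1 : ℤ) : ℚ),((3 : ℤ) : ℚ)], (a ∈ order (-1) 3 ∨ a - ⟨1/2, 1/2, 1/2, -1/2⟩ ∈ order (-1) 3) →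
          ∃ b : ℍ[ℚ,((-1 : ℤ) : ℚ),((3 : ℤ) : ℚ)], (b ∈ order (-1) 3 ∨ b - ⟨1/2, 1/2, 1/2, -1/2⟩ ∈ order (-1) 3) ∧
            g * a = b * g) ∧
        0 < (g * star g).re ∧ moebius (rho (-1) 3 (by norm_num) (castQ (-1) 3 g)) p.1 = q.1) //
      Nat.card {a : Quot (fun p q : {τ : ℂ // 0 < τ.im ∧ ∃ x : ℍ[ℚ,((-1 : ℤ) : ℚ),((3 : ℤ) : ℚ)],
        x ∈ order (-1) 3 ∧ x.re = 0 ∧ (x * star x).re = t ∧ moebius (rho (-1) 3 (by norm_num) (castQ (-1) 3 x)) τ = τ} ↦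
      ∃ v : ℍ[ℚ,((-1 : ℤ) : ℚ),((3 : ℤ) : ℚ)], (v ∈ order (-1) 3 ∨ v - ⟨1/2, 1/2, 1/2, -1/2⟩ ∈ order (-1) 3) ∧
        v * star v = 1 ∧ moebius (rho (-1) 3 (by norm_num) (castQ (-1) 3 v)) p.1 = q.1) //
      Quot.factor
      (fun p q : {τ : ℂ // 0 < τ.im ∧ ∃ x : ℍ[ℚ,((-1 : ℤ) : ℚ),((3 : ℤ) : ℚ)],
        x ∈ order (-1) 3 ∧ x.re = 0 ∧ (x * star x).re = t ∧ moebius (rho (-1) 3 (by norm_num) (castQ (-1) 3 x)) τ = τ} ↦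
        ∃ v : ℍ[ℚ,((-1 : ℤ) : ℚ),((3 : ℤ) : ℚ)], (v ∈ order (-1) 3 ∨ v - ⟨1/2, 1/2, 1/2, -1/2⟩ ∈ order (-1) 3) ∧
        v * star v = 1 ∧ moebius (rho (-1) 3 (by norm_num) (castQ (-1) 3 v)) p.1 = q.1)
      (fun p q : {τ : ℂ // 0 < τ.im ∧ ∃ x : ℍ[ℚ,((-1 : ℤ) : ℚ),((3 : ℤ) : ℚ)],
        x ∈ order (-1) 3 ∧ x.re = 0 ∧ (x * star x).re = t ∧ moebius (rho (-1) 3 (by norm_num) (castQ (-1) 3 x)) τ = τ} ↦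
        ∃ g : ℍ[ℚ,((-1 : ℤ) : ℚ),((3 : ℤ) : ℚ)], g ≠ 0 ∧
        (∀ a : ℍ[ℚ,((-1 : ℤ) : ℚ),((3 : ℤ) : ℚ)], (a ∈ order (-1) 3 ∨ a - ⟨1/2, 1/2, 1/2, -1/2⟩ ∈ order (-1) 3) →
          ∃ b : ℍ[ℚ,((-1 : ℤ) : ℚ),((3 : ℤ) : ℚ)], (b ∈ order (-1) 3 ∨ b - ⟨1/2, 1/2, 1/2, -1/2⟩ ∈ order (-1) 3) ∧
            g * a = b * g) ∧
        0 < (g * star g).re ∧ moebius (rho (-1) 3 (by norm_num) (castQ (-1) 3 g)) p.1 = q.1)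
      (specialPointsPlus_rel_of_specialPoints_rel t) a = c} = 2} ≤ 1 := by
  haveI := finite_specialPointsPlus ht
  haveI := subsingleton_twoFibres ht
  exact Finite.card_le_one_iff_subsingleton.2 ‹_›

/-- **EXACTLY ONE TWO-CLASS FIBRE IFF `t ∈ ℤ² ∪ 3ℤ² ∪ 6ℤ²`** (`t > 0`): existence from `Pt(t₀) ⊆ Pt(m²t₀)` and
`Pt(t₀) ≠ ∅` (`#(Pt(t₀)/Γ₆) = 2`, `t₀ = 1, 3, 6`). [cite: Ogg1983RealPoints, §2 p. 284 and (4)] [cite: BayerTravesa2007, §1 Thm. 1.1, §2 and §7 Table 9] [cite: KudlaRapoportYang2006, §3.4 (3.4.6), (3.4.9) and Remark 3.4.7] -/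
theorem card_twoFibres_eq_one_iff {t : ℤ} (ht : 0 < t) :
    Nat.card {c : Quot (fun p q : {τ : ℂ // 0 < τ.im ∧ ∃ x : ℍ[ℚ,((-1 : ℤ) : ℚ),((3 : ℤ) : ℚ)],
        x ∈ order (-1) 3 ∧ x.re = 0 ∧ (x * star x).re = t ∧ moebius (rho (-1) 3 (by norm_num) (castQ (-1) 3 x)) τ = τ} ↦
      ∃ g : ℍ[ℚ,((-1 : ℤ) : ℚ),((3 : ℤ) : ℚ)], g ≠ 0 ∧
        (∀ a : ℍ[ℚ,((-1 : ℤ) : ℚ),((3 : ℤ) : ℚ)], (a ∈ order (-1) 3 ∨ a - ⟨1/2, 1/2, 1/2, -1/2⟩ ∈ order (-1) 3) →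
          ∃ b : ℍ[ℚ,((-1 : ℤ) : ℚ),((3 : ℤ) : ℚ)], (b ∈ order (-1) 3 ∨ b - ⟨1/2, 1/2, 1/2, -1/2⟩ ∈ order (-1) 3) ∧
            g * a = b * g) ∧
        0 < (g * star g).re ∧ moebius (rho (-1) 3 (by norm_num) (castQ (-1) 3 g)) p.1 = q.1) //
      Nat.card {a : Quot (fun p q : {τ : ℂ // 0 < τ.im ∧ ∃ x : ℍ[ℚ,((-1 : ℤ) : ℚ),((3 : ℤ) : ℚ)],
        x ∈ order (-1) 3 ∧ x.re = 0 ∧ (x * star x).re = t ∧ moebius (rho (-1) 3 (by norm_num) (castQ (-1) 3 x)) τ = τ} ↦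
      ∃ v : ℍ[ℚ,((-1 : ℤ) : ℚ),((3 : ℤ) : ℚ)], (v ∈ order (-1) 3 ∨ v - ⟨1/2, 1/2, 1/2, -1/2⟩ ∈ order (-1) 3) ∧
        v * star v = 1 ∧ moebius (rho (-1) 3 (by norm_num) (castQ (-1) 3 v)) p.1 = q.1) //
      Quot.factor
      (fun p q : {τ : ℂ // 0 < τ.im ∧ ∃ x : ℍ[ℚ,((-1 : ℤ) : ℚ),((3 : ℤ) : ℚ)],
        x ∈ order (-1) 3 ∧ x.re = 0 ∧ (x * star x).re = t ∧ moebius (rho (-1) 3 (by norm_num) (castQ (-1) 3 x)) τ = τ} ↦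
        ∃ v : ℍ[ℚ,((-1 : ℤ) : ℚ),((3 : ℤ) : ℚ)], (v ∈ order (-1) 3 ∨ v - ⟨1/2, 1/2, 1/2, -1/2⟩ ∈ order (-1) 3) ∧
        v * star v = 1 ∧ moebius (rho (-1) 3 (by norm_num) (castQ (-1) 3 v)) p.1 = q.1)
      (fun p q : {τ : ℂ // 0 < τ.im ∧ ∃ x : ℍ[ℚ,((-1 : ℤ) : ℚ),((3 : ℤ) : ℚ)],
        x ∈ order (-1) 3 ∧ x.re = 0 ∧ (x * star x).re = t ∧ moebius (rho (-1) 3 (by norm_num) (castQ (-1) 3 x)) τ = τ} ↦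
        ∃ g : ℍ[ℚ,((-1 : ℤ) : ℚ),((3 : ℤ) : ℚ)], g ≠ 0 ∧
        (∀ a : ℍ[ℚ,((-1 : ℤ) : ℚ),((3 : ℤ) : ℚ)], (a ∈ order (-1) 3 ∨ a - ⟨1/2, 1/2, 1/2, -1/2⟩ ∈ order (-1) 3) →
          ∃ b : ℍ[ℚ,((-1 : ℤ) : ℚ),((3 : ℤ) : ℚ)], (b ∈ order (-1) 3 ∨ b - ⟨1/2, 1/2, 1/2, -1/2⟩ ∈ order (-1) 3) ∧
            g * a = b * g) ∧
        0 < (g * star g).re ∧ moebius (rho (-1) 3 (by norm_num) (castQ (-1) 3 g)) p.1 = q.1)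
      (specialPointsPlus_rel_of_specialPoints_rel t) a = c} = 2} = 1 ↔
    ∃ m : ℤ, t = m ^ 2 ∨ t = 3 * m ^ 2 ∨ t = 6 * m ^ 2 := by
  haveI := subsingleton_twoFibres ht
  rw [Nat.card_eq_one_iff_unique]
  constructor
  · rintro ⟨-, ⟨⟨c, hc⟩⟩⟩
    induction c using Quot.ind with
    | _ p =>
      obtain ⟨x, -, hxre, hxn, hfx⟩ := p.2.2
      rcases (card_fibre_eq_two_iff p).1 hc with ⟨y, -, hyre, hyn, hfy⟩ | ⟨y, -, hyre, hyn, hfy⟩ | ⟨y, -, hyre, hyn, hfy⟩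
      · obtain ⟨m, hm⟩ := exists_eq_sq_of_specialPoints_inter_one p.2.1.ne' hxre hyre hxn hyn hfx hfy
        exact ⟨m, Or.inl hm⟩
      · obtain ⟨m, hm⟩ := exists_eq_three_mul_sq_of_specialPoints_inter_three p.2.1.ne' hxre hyre hxn hyn hfx hfy
        exact ⟨m, Or.inr (Or.inl hm)⟩
      · obtain ⟨m, hm⟩ := exists_eq_six_mul_sq_of_specialPoints_inter_six p.2.1.ne' hxre hyre hxn hyn hfx hfy
        exact ⟨m, Or.inr (Or.inr hm)⟩
  · intro h
    refine ⟨‹_›, ?_⟩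
    -- a point of `Pt(t₀)`, `t₀ = 1, 3, 6`, from `#(Pt(t₀)/Γ₆) = 2 ≠ 0`
    have pt : ∀ t₀ : ℤ, Nat.card (Quot (fun p q : {τ : ℂ // 0 < τ.im ∧ ∃ x : ℍ[ℚ,((-1 : ℤ) : ℚ),((3 : ℤ) : ℚ)],
        x ∈ order (-1) 3 ∧ x.re = 0 ∧ (x * star x).re = t₀ ∧ moebius (rho (-1) 3 (by norm_num) (castQ (-1) 3 x)) τ = τ} ↦
              ∃ v : ℍ[ℚ,((-1 : ℤ) : ℚ),((3 : ℤ) : ℚ)], (v ∈ order (-1) 3 ∨ v - ⟨1/2, 1/2, 1/2, -1/2⟩ ∈ order (-1) 3) ∧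
        v * star v = 1 ∧ moebius (rho (-1) 3 (by norm_num) (castQ (-1) 3 v)) p.1 = q.1)) ≠ 0 →
        ∃ τ : ℂ, 0 < τ.im ∧ ∃ y : ℍ[ℚ,((-1 : ℤ) : ℚ),((3 : ℤ) : ℚ)], y ∈ order (-1) 3 ∧ y.re = 0 ∧ (y * star y).re = t₀ ∧
          moebius (rho (-1) 3 (by norm_num) (castQ (-1) 3 y)) τ = τ := by
      intro t₀ h0
      obtain ⟨c⟩ := (Nat.card_ne_zero.1 h0).1
      induction c using Quot.ind with
      | _ p => exact ⟨p.1, p.2.1, p.2.2⟩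
    -- transport it to `Pt(m²t₀) = Pt(t)`
    have lift : ∀ (t₀ m : ℤ), m ≠ 0 → t = m ^ 2 * t₀ → ∀ τ : ℂ, 0 < τ.im →
        (∃ y : ℍ[ℚ,((-1 : ℤ) : ℚ),((3 : ℤ) : ℚ)], y ∈ order (-1) 3 ∧ y.re = 0 ∧ (y * star y).re = t₀ ∧
          moebius (rho (-1) 3 (by norm_num) (castQ (-1) 3 y)) τ = τ) →
        ∃ p : {τ : ℂ // 0 < τ.im ∧ ∃ x : ℍ[ℚ,((-1 : ℤ) : ℚ),((3 : ℤ) : ℚ)],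
        x ∈ order (-1) 3 ∧ x.re = 0 ∧ (x * star x).re = t ∧ moebius (rho (-1) 3 (by norm_num) (castQ (-1) 3 x)) τ = τ}, p.1 = τ := by
      intro t₀ m hm htm τ hτ hy
      have hx := specialPoints_mono_sq_mul (t₀ := t₀) hm (τ := τ) hy
      rw [← htm] at hx
      exact ⟨⟨τ, hτ, hx⟩, rfl⟩
    obtain ⟨m, hm | hm | hm⟩ := h
    · have hm0 : m ≠ 0 := by rintro rfl; rw [hm] at ht; norm_num at ht
      obtain ⟨τ, hτ, hy⟩ := pt 1 (by rw [card_specialPoints_table.1]; norm_num)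
      obtain ⟨p, rfl⟩ := lift 1 m hm0 (by rw [hm, mul_one]) τ hτ hy
      exact ⟨⟨Quot.mk _ p, card_fibre_eq_two_of_mem_one p (by push_cast at hy; exact hy)⟩⟩
    · have hm0 : m ≠ 0 := by rintro rfl; rw [hm] at ht; norm_num at ht
      obtain ⟨τ, hτ, hy⟩ := pt 3 (by rw [card_specialPoints_table.2.1]; norm_num)
      obtain ⟨p, rfl⟩ := lift 3 m hm0 (by rw [hm, mul_comm]) τ hτ hy
      exact ⟨⟨Quot.mk _ p, card_fibre_eq_two_of_mem_three p (by push_cast at hy; exact hy)⟩⟩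
    · have hm0 : m ≠ 0 := by rintro rfl; rw [hm] at ht; norm_num at ht
      obtain ⟨τ, hτ, hy⟩ := pt 6 (by rw [card_specialPoints_table.2.2.1]; norm_num)
      obtain ⟨p, rfl⟩ := lift 6 m hm0 (by rw [hm, mul_comm]) τ hτ hy
      exact ⟨⟨Quot.mk _ p, card_fibre_eq_two_of_mem_six p (by push_cast at hy; exact hy)⟩⟩

/-- **NO TWO-CLASS FIBRE IFF `t ∉ ℤ² ∪ 3ℤ² ∪ 6ℤ²`** (`t > 0`): then `W` acts freely on the points of `Z(t)` on `X₆`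
and `#(Pt(t)/Γ₆) = 4·#(Pt(t)/Γ₆⁺)`. [cite: KudlaRapoportYang2006, §3.4 Remark 3.4.7] [cite: Ogg1983RealPoints, §2 (2)–(4)] [cite: BayerTravesa2007, §2] -/
theorem card_twoFibres_eq_zero_iff {t : ℤ} (ht : 0 < t) :
    Nat.card {c : Quot (fun p q : {τ : ℂ // 0 < τ.im ∧ ∃ x : ℍ[ℚ,((-1 : ℤ) : ℚ),((3 : ℤ) : ℚ)],
        x ∈ order (-1) 3 ∧ x.re = 0 ∧ (x * star x).re = t ∧ moebius (rho (-1) 3 (by norm_num) (castQ (-1) 3 x)) τ = τ} ↦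
      ∃ g : ℍ[ℚ,((-1 : ℤ) : ℚ),((3 : ℤ) : ℚ)], g ≠ 0 ∧
        (∀ a : ℍ[ℚ,((-1 : ℤ) : ℚ),((3 : ℤ) : ℚ)], (a ∈ order (-1) 3 ∨ a - ⟨1/2, 1/2, 1/2, -1/2⟩ ∈ order (-1) 3) →
          ∃ b : ℍ[ℚ,((-1 : ℤ) : ℚ),((3 : ℤ) : ℚ)], (b ∈ order (-1) 3 ∨ b - ⟨1/2, 1/2, 1/2, -1/2⟩ ∈ order (-1) 3) ∧
            g * a = b * g) ∧
        0 < (g * star g).re ∧ moebius (rho (-1) 3 (by norm_num) (castQ (-1) 3 g)) p.1 = q.1) //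
      Nat.card {a : Quot (fun p q : {τ : ℂ // 0 < τ.im ∧ ∃ x : ℍ[ℚ,((-1 : ℤ) : ℚ),((3 : ℤ) : ℚ)],
        x ∈ order (-1) 3 ∧ x.re = 0 ∧ (x * star x).re = t ∧ moebius (rho (-1) 3 (by norm_num) (castQ (-1) 3 x)) τ = τ} ↦
      ∃ v : ℍ[ℚ,((-1 : ℤ) : ℚ),((3 : ℤ) : ℚ)], (v ∈ order (-1) 3 ∨ v - ⟨1/2, 1/2, 1/2, -1/2⟩ ∈ order (-1) 3) ∧
        v * star v = 1 ∧ moebius (rho (-1) 3 (by norm_num) (castQ (-1) 3 v)) p.1 = q.1) //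
      Quot.factor
      (fun p q : {τ : ℂ // 0 < τ.im ∧ ∃ x : ℍ[ℚ,((-1 : ℤ) : ℚ),((3 : ℤ) : ℚ)],
        x ∈ order (-1) 3 ∧ x.re = 0 ∧ (x * star x).re = t ∧ moebius (rho (-1) 3 (by norm_num) (castQ (-1) 3 x)) τ = τ} ↦
        ∃ v : ℍ[ℚ,((-1 : ℤ) : ℚ),((3 : ℤ) : ℚ)], (v ∈ order (-1) 3 ∨ v - ⟨1/2, 1/2, 1/2, -1/2⟩ ∈ order (-1) 3) ∧
        v * star v = 1 ∧ moebius (rho (-1) 3 (by norm_num) (castQ (-1) 3 v)) p.1 = q.1)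
      (fun p q : {τ : ℂ // 0 < τ.im ∧ ∃ x : ℍ[ℚ,((-1 : ℤ) : ℚ),((3 : ℤ) : ℚ)],
        x ∈ order (-1) 3 ∧ x.re = 0 ∧ (x * star x).re = t ∧ moebius (rho (-1) 3 (by norm_num) (castQ (-1) 3 x)) τ = τ} ↦
        ∃ g : ℍ[ℚ,((-1 : ℤ) : ℚ),((3 : ℤ) : ℚ)], g ≠ 0 ∧
        (∀ a : ℍ[ℚ,((-1 : ℤ) : ℚ),((3 : ℤ) : ℚ)], (a ∈ order (-1) 3 ∨ a - ⟨1/2, 1/2, 1/2, -1/2⟩ ∈ order (-1) 3) →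
          ∃ b : ℍ[ℚ,((-1 : ℤ) : ℚ),((3 : ℤ) : ℚ)], (b ∈ order (-1) 3 ∨ b - ⟨1/2, 1/2, 1/2, -1/2⟩ ∈ order (-1) 3) ∧
            g * a = b * g) ∧
        0 < (g * star g).re ∧ moebius (rho (-1) 3 (by norm_num) (castQ (-1) 3 g)) p.1 = q.1)
      (specialPointsPlus_rel_of_specialPoints_rel t) a = c} = 2} = 0 ↔
    ¬ ∃ m : ℤ, t = m ^ 2 ∨ t = 3 * m ^ 2 ∨ t = 6 * m ^ 2 := by
  have h1 := card_twoFibres_le_one ht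
  have h2 := card_twoFibres_eq_one_iff ht
  constructor
  · intro h0 hany
    rw [← h2] at hany
    omega
  · intro hne
    rcases Nat.le_one_iff_eq_zero_or_eq_one.1 h1 with h | h
    · exact h
    · exact absurd (h2.1 h) hne

end TwoFibres

end Literature.Geometry.Kaehler.ComplexTorus.QuaternionType
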